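import Mathlib
import Summits.ValiantsHypothesis.ValiantsHypothesis.Theses.RigidityForcesSymmetry
import Summits.ValiantsHypothesis.ValiantsHypothesis.Theorems.LaplaceOptimalFive.Negative.SignPatternCheap
import Summits.ValiantsHypothesis.ValiantsHypothesis.Theorems.RigidityForcesSymmetryRankRigidMinimalReprLaplaceFiveSectorSplitDefs

/-!
# SignPencilSketch — crux idea #9 `sign-pencil` on `LaplaceOptimalFive` (stmt-ValiantsHypothesis-24813)

val-idea-19 g9 (planner, crux-ideate style).  HONEST LABEL: nothing here proves `LaplaceOptimalFive`,
`LaplaceBridging` or VP ≠ VNP.  This file holds the KERNEL FACTS of the card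
`Cruxes/LaplaceOptimalFive/Ideas/sign-pencil.md`:

* §0  integer tables: the permutation pattern `P₅` (`pat5`), the Levi-Civita pattern `D₅` (`sgn5`),
      the two halves `A⁺`/`A⁻` of the SIGN PENCIL `T_s = A⁺ + s·A⁻` (`P₅ = T₁`, `D₅ = T₋₁`), the letter
      transposition symmetry `A⁺ ↔ A⁻` (`aPlus_eq_aMinus_sw`) and `T_s + T_{2−s} = 2P₅`
      (`pencil_pair_sum`) behind the PENCIL INEQUALITIES `w(P₅) ≤ 2w(A⁻)`, `w(P₅) ≤ w(D₅) + w(T₃)`, and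
      the determinant's honest weight-72 HUB DESIGN (`hub_design`, = `SignPatternCheap.sign_five_hub_identity`
      in named form: `D₅ = θ⊗Ω + Σ_k ± ω_{0k} ⊗ (θ∧ω)`).
* §1  the NINE-WORD INTEGRAL CERTIFICATE `phi9` (+1 on the six permutations `(2,0,σ(1,3,4))`, −1 on the
      three junk words `(0,0,{1,1,4})`): it annihilates all ten generator families of the tangent space
      of the hub design (`phi9_slice_*`, `phi9_pair*_short`, `phi9_pair*_long`) and pairs to
      `3 / 3 / 6 / 0` with `A⁻ / A⁺ / P₅ / D₅` (`phi9_pair_aMinus` …).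
* §2  consequences: the hub design is SIGN-RIGID to first order (`hub_sign_rigid`: no integer tangent
      vector equals `A⁻`), has DYADIC HEIGHT ZERO (`hub_dyadic_height_zero`: none is even ≡ A⁻ mod 2) and —
      the headline — admits NO LIFT MOD 4: no weight-72 system over ℤ reducing mod 2 to the hub design
      multiplies out to `P₅` modulo 4 (`hub_no_mod4_lift`), although `P₅ ≡ D₅ (mod 2)`.
      §2b, over `ℂ` with ARBITRARY long factors: the pencil meets the hub configuration only at `D₅`
      (`hub_configuration_pencil_only_D5`: long factors writing `T_s` on the short factors `θ, ω(v₀,v_k)`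
      force `s = −1`, since `⟨Φ₉,T_s⟩ = 3 + 3s` and `Φ₉ ⊥ L(U_hub)`); corollaries
      `hub_configuration_misses_P5` / `_misses_aMinus` — the first kernel instance of K1's mechanism
      (a D-feasible configuration misses `P₅` because a functional on `L(U)` separates the pencil).
      §2c: the p629937 STAR BORDER CONFIGURATION `U_B(ε)` is D-INFEASIBLE for every `ε`
      (`star_border_configuration_D_infeasible`, two-word certificate; also `_misses_aMinus`) — the
      D-feasible sector does not contain the border class of record (honest scope of K1).
      §2d (rev 8): two EXACT slice-free tail designs of `D₅` with entries in `{0,±1}` — `hub2222_design`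
      (profile `2·01+2·02+2·03+2·04` ⊂ StarTail, weight 96: the hub slice `θ(v₀)·Ω`, `Ω = e⁰∧e¹∧e²∧e³`,
      re-expanded by the shuffle formula, one term per slot) and `twohub84_design` (profile
      `01+02+03+04+12+13+14` ⊂ SixTail, weight 84: the slice re-expanded with hub slot 1) — and the
      TWO-WORD CERTIFICATE `δ₍₂,₃,₀,₁,₄₎ + δ₍₃,₂,₀,₁,₄₎`: both configurations (arbitrary long factors) meet the
      pencil only at `D₅` (`hub2222_configuration_pencil_only_D5`, `twohub84_configuration_pencil_only_D5`,
      `…_misses_P5`, `…_misses_aMinus`) — K1-instances nos. 2, 3, slice-free and exact.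
      §2e (rev 10): both tail designs have DYADIC HEIGHT ZERO / NO MOD-4 LIFT to `P₅`
      (`hub2222_dyadic_height_zero`, `hub2222_no_mod4_lift` by `Φ₉`; `twohub84_dyadic_height_zero`,
      `twohub84_no_mod4_lift` by the new nine-word certificate `Ψ₉`).
* §3  the typed K1 of the card, `DFeasibleLaplaceOptimalFive` (the crux restricted to configurations that
      also carry an honest design of `D₅`), its honesty lemma (it is a CONSEQUENCE of the crux, not a
      strengthening) and the PENCIL DICHOTOMY (`pencil_dichotomy`): a D-design and a P-design on the same
      short factors give a design of `2·A⁻` on the same configuration.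
* §4  DESIGN ALGEBRA in `LaplaceOptimal`'s exact data format (concatenation on `Fin (N₁ + N₂)` — weights
      add; letter relabelling; rescaling; `pat5_indicator`: the table `pat5` IS the injectivity indicator;
      `sgn5_inline`: `sgn5` IS the target of `sign_five_cheap`) and the PENCIL INEQUALITIES as theorems:
      `laplaceOptimalFive_weight_aMinus` (LO5 ⟹ every honest design of `A⁻` has weight ≥ 60),
      `laplaceOptimalFive_weight_pencil_pair` (LO5 ⟹ `w(T_s) + w(T_{2−s}) ≥ 120`, all `s : ℂ`),
      `laplaceOptimalFive_weight_T3` (LO5 ⟹ every honest design of `T₃ = A⁺ + 3A⁻ = 2P₅ − D₅` has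
      weight ≥ 48, via the tree's `sign_five_cheap`).  So falsifier F0 is a KERNEL refutation path: one
      honest design of `A⁻` of weight ≤ 48, or of `T₃` of weight ≤ 36, gives `¬ LaplaceOptimalFive`.
* §5  PRICE Π2(a) of the verdict (crit-3 g6 2026-08-29T02:04:37Z, director R340 (2)) — δ TIED TO THE LINE's
      SECTORS, kernel: `sideSymmetric_not_D_design` (NO side-symmetric split system — the tree's
      `LaplaceFiveSectorSplit.SideSymmetric` — writes `D₅`, on any profile, slices included: the «sign
      projector» remark of LINE shallow_collision S2′/S3′ as a theorem); `symShort_sliceFree_not_D_design`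
      (configuration level, `u`-only: on a SLICE-FREE profile, slot-symmetric short factors admit NO co-local
      long factors writing `D₅` — `δ = 0`); hence `dFeasible_sliceFree_not_sideSymmetric` (`δ = 1` on a
      slice-free profile ⟹ every `P₅`-system on the configuration is in the ASYMMETRIC sector) and
      `dFeasibleSliceFree_of_asymSector` (K1 restricted to slice-free profiles is implied by the tree's
      `AsymLaplaceOptimalFive`): the pencil's tool acts on a SUB-SECTOR OF S3′ (the residual law), and S2′'s
      symmetric sector — honest pair-Laplace included — is entirely `δ = 0` (K3).  Π2(b) («a minimal
      asymmetric `P₅`-carrier is D-feasible») is NOT claimed: the p629937 star border configuration is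
      asymmetric with `δ = 0` (§2c).
* §6  the PENCIL LEMMA in kernel (`dFeasibleOn_of_hGen : HGen Π → DFeasibleLO5On Π` for every profile
      predicate `Π` — a D-design and a P-design on the same short factors give a design of every `T_s`,
      `pencil_member_design`) and K2 TYPED TODAY without closure vocabulary (crit-3 sharpening):
      `HGenStar` / `HGenSix` on the two LM tail profiles `StarTail` (`3·01+2·02+2·03+2·04`) and `SixTail`
      (`2·01+02+03+04+12+13+14`), with `dFeasibleLO5On_star_of_hGen` / `_six_of_hGen`; HONESTY of K2:
      `hGenStar_of_laplaceOptimalFive` / `hGenSix_of_laplaceOptimalFive` (instance `s₀ = 1`, via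
      `starTail_weight_le` ≤ 108 / `sixTail_weight_le` ≤ 96) — so `LO5|π ⟹ HGen π ⟹ K1|π`: K2 is a
      sector-type consequence of the crux whose content is an instance `s₀ ≠ ±1`.
      §6b (rev 8): navigating the pencil for F1 in kernel — `pencilT_sw` (`T_s∘(0 1) = A⁻ + s·A⁺`),
      `designOn_aPlus_iff_aMinus` (`s = 0 ↔ ∞`), `designOn_pencilT_inv_iff` (`T_s ↔ T_{1/s}`, `s ≠ 0`) on
      every profile predicate; `pencilT_zero`, `pencilT_neg_one`.
      §6c (rev 8): `δ = 1` OCCURS HONESTLY ON BOTH TAILS, EXACTLY: `designOn_starTail_D5` (weight 96) and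
      `designOn_sixTail_D5` (weight 84) — explicit `Fin 8` / `Fin 7` systems in LO5's data format built
      from §2d; so K1 is non-vacuous on StarTail and SixTail, and an `HGen` witness has `s₀ ≠ −1`
      (`hGenStar_witness_ne_neg_one`, `hGenSix_witness_ne_neg_one`) besides `s₀ ≠ 1` under the crux:
      F1's content test is `s = 0` (then generic `s` mod `s ↦ 1/s`); the kit item «sign on SixTail» is moot.
* §7  (rev 9) the TWO-WORD PENCIL LEMMA in general form (`twoWord_pencil`, `twoWord_pencil_sign`,
      `twoWord_only_D5` / `twoWord_only_P5`) and the typed instances `hub2222_typed_pencil_only_D5`,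
      `twohub84_typed_pencil_only_D5` (certificates `u8_twoWord_cert`, `u7_twoWord_cert` by `decide`).
* §9  (rev 11) lives in the COMPANION FILE `Cruxes/LaplaceOptimalFive/SignPencilChowClass.lean` (this file
      would exceed the workfile size cap): THEOREM A — K1 ON THE WHOLE `GL₅`-CLASS OF THE HUB
      CONFIGURATION, kernel, 0 sorry (`SignPencil.ChowClass.chow_not_InLhub`, `K1_hubClass`,
      `K1_star2222Class`): for every invertible `G` and ARBITRARY long factors,
      `G·P₅ ∉ θ⊗V⁴ + Σ_k ω_{0k}⊗V³` (`G·P₅ = chow G`, the Ryser form of the permanent of the row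
      selection); i.e. no configuration in the `GL₅`-orbit of the hub design (§0) or of the `2222` star
      design (§2d) carries `P₅`, though all carry `D₅` — the first K1 theorem for a positive-dimensional
      FAMILY of D-feasible configurations (§2b–§2d, §7 are single configurations).  Ingredients: the
      support set of `L(U_hub)`; the expansion `Σ_w y^{⊗4}·chow G = R(G_a, yᵀG) = 24·D(G_a, yᵀG)`; a CORE
      LEMMA forcing the columns of `G⁻¹` met by the support argument to be coordinate vectors; column
      normal form; Ryser evaluation = product of pivots; the two-word certificate of §7.
-/

set_option autoImplicit false
set_option maxHeartbeats 4000000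
set_option linter.dupNamespace false

namespace Summit.ValiantsHypothesis.ValiantsHypothesis.Cruxes.LaplaceOptimalFive.SignPencil

open Finset

/-! ## §0 Tables -/

/-- The permutation pattern `P₅` as an integer table. -/
def pat5 (a b c d e : Fin 5) : ℤ :=
  if a ≠ b ∧ a ≠ c ∧ a ≠ d ∧ a ≠ e ∧ b ≠ c ∧ b ≠ d ∧ b ≠ e ∧ c ≠ d ∧ c ≠ e ∧ d ≠ e then 1 else 0

/-- Sign of an ordered pair of letters. -/
def sg (x y : Fin 5) : ℤ := if x < y then 1 else if y < x then -1 else 0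

/-- The Levi-Civita pattern `D₅` (sign of the word, `0` on non-injective words). -/
def sgn5 (a b c d e : Fin 5) : ℤ :=
  sg a b * sg a c * sg a d * sg a e * sg b c * sg b d * sg b e * sg c d * sg c e * sg d e

/-- Odd-permutation indicator `A⁻ = (P₅ − D₅)/2`. -/
def aMinus (a b c d e : Fin 5) : ℤ := if sgn5 a b c d e = -1 then 1 else 0

/-- Even-permutation indicator `A⁺ = (P₅ + D₅)/2`. -/
def aPlus (a b c d e : Fin 5) : ℤ := if sgn5 a b c d e = 1 then 1 else 0

theorem pat5_eq_aPlus_add_aMinus :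
    ∀ a b c d e : Fin 5, pat5 a b c d e = aPlus a b c d e + aMinus a b c d e := by decide

theorem sgn5_eq_aPlus_sub_aMinus :
    ∀ a b c d e : Fin 5, sgn5 a b c d e = aPlus a b c d e - aMinus a b c d e := by decide

/-- the letter transposition `(0 1)`. -/
def sw (x : Fin 5) : Fin 5 := if x = 0 then 1 else if x = 1 then 0 else x

/-- `A⁺` and `A⁻` are exchanged by relabelling the letters with a transposition; hence they have the
same honest weight on every profile, and `P₅ = A⁺ + A⁻` gives the PENCIL INEQUALITY
`w(P₅) ≤ 2·w(A⁻)`: `LaplaceOptimalFive` forces `w(A⁻) ≥ 60` (cheapest falsifier F0 of the card). -/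
theorem aPlus_eq_aMinus_sw :
    ∀ a b c d e : Fin 5, aPlus a b c d e = aMinus (sw a) (sw b) (sw c) (sw d) (sw e) := by decide

/-- `T_s + T_{2−s} = 2·P₅` on tables: `(A⁺ + s·A⁻) + (A⁺ + (2−s)·A⁻) = 2·(A⁺ + A⁻)`; with `s = −1`
this is `D₅ + T₃ = 2·P₅`, `T₃ = A⁺ + 3·A⁻` (pencil inequality `w(P₅) ≤ w(D₅) + w(T₃) ≤ 72 + w(T₃)`). -/
theorem pencil_pair_sum (s : ℤ) : ∀ a b c d e : Fin 5,
    (aPlus a b c d e + s * aMinus a b c d e) + (aPlus a b c d e + (2 - s) * aMinus a b c d e)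
      = 2 * pat5 a b c d e := by
  intro a b c d e; rw [pat5_eq_aPlus_add_aMinus]; ring

/-- `θ = e₄^*`. -/
def th (x : Fin 5) : ℤ := if x = 4 then 1 else 0

/-- `ω = e₀∧e₁ + e₂∧e₃` (rank-4 alternating form on the letters `0,1,2,3`). -/
def om (x y : Fin 5) : ℤ :=
  if x = 0 ∧ y = 1 then 1 else if x = 1 ∧ y = 0 then -1
  else if x = 2 ∧ y = 3 then 1 else if x = 3 ∧ y = 2 then -1 else 0

/-- `Ω = ω∧ω/2`. -/
def Om (b c d e : Fin 5) : ℤ := om b c * om d e - om b d * om c e + om b e * om c d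

/-- `θ∧ω`. -/
def thom (x y z : Fin 5) : ℤ := th x * om y z - th y * om x z + th z * om x y

/-- The determinant's honest HUB DESIGN of weight `1·24 + 4·12 = 72` (slice at slot 0 + the four pairs
`{0,k}`): `D₅ = θ⊗Ω + ω₀₁⊗(θ∧ω) − ω₀₂⊗(θ∧ω) + ω₀₃⊗(θ∧ω) − ω₀₄⊗(θ∧ω)`. -/
theorem hub_design : ∀ a b c d e : Fin 5,
    th a * Om b c d e + om a b * thom c d e - om a c * thom b d e + om a d * thom b c e
      - om a e * thom b c d = sgn5 a b c d e := by decide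

/-! ## §1 The nine-word integral certificate -/

/-- `Φ₉`: `+1` on the six permutations `(2,0,σ(1,3,4))`, `−1` on the three junk words `(0,0,·)` with
letters `{1,1,4}` on the last three slots, `0` elsewhere. -/
def phi9 (a b c d e : Fin 5) : ℤ :=
  if a = 2 ∧ b = 0 ∧ ((c = 1 ∧ d = 3 ∧ e = 4) ∨ (c = 1 ∧ d = 4 ∧ e = 3) ∨ (c = 3 ∧ d = 1 ∧ e = 4) ∨
      (c = 3 ∧ d = 4 ∧ e = 1) ∨ (c = 4 ∧ d = 1 ∧ e = 3) ∨ (c = 4 ∧ d = 3 ∧ e = 1)) then 1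
  else if a = 0 ∧ b = 0 ∧ ((c = 1 ∧ d = 1 ∧ e = 4) ∨ (c = 1 ∧ d = 4 ∧ e = 1) ∨ (c = 4 ∧ d = 1 ∧ e = 1))
    then -1 else 0

/-- `Φ₉ ⊥ (V ⊗ Ω)` on the slice `{0}` — pointwise. -/
theorem phi9_slice_long_pt : ∀ a b c d e : Fin 5, Om b c d e * phi9 a b c d e = 0 := by decide

/-- `Φ₉ ⊥ (θ ⊗ V^{⊗4})` on the slice `{0}` — pointwise (`Φ₉` vanishes on words starting with `4`). -/
theorem phi9_slice_short_pt : ∀ a b c d e : Fin 5, th a * phi9 a b c d e = 0 := by decide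

/-- `Φ₉ ⊥ ω₀₁ ⊗ V^{⊗3}`. -/
theorem phi9_pair1_short : ∀ c d e : Fin 5, ∑ a, ∑ b, om a b * phi9 a b c d e = 0 := by
  simp only [Fin.sum_univ_five]; decide
/-- `Φ₉ ⊥ ω₀₂ ⊗ V^{⊗3}`. -/
theorem phi9_pair2_short : ∀ b d e : Fin 5, ∑ a, ∑ c, om a c * phi9 a b c d e = 0 := by
  simp only [Fin.sum_univ_five]; decide
/-- `Φ₉ ⊥ ω₀₃ ⊗ V^{⊗3}`. -/
theorem phi9_pair3_short : ∀ b c e : Fin 5, ∑ a, ∑ d, om a d * phi9 a b c d e = 0 := by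
  simp only [Fin.sum_univ_five]; decide
/-- `Φ₉ ⊥ ω₀₄ ⊗ V^{⊗3}`. -/
theorem phi9_pair4_short : ∀ b c d : Fin 5, ∑ a, ∑ e, om a e * phi9 a b c d e = 0 := by
  simp only [Fin.sum_univ_five]; decide

/-- `Φ₉ ⊥ V^{⊗2} ⊗ (θ∧ω)` on the pair `{0,1}`. -/
theorem phi9_pair1_long : ∀ a b : Fin 5, ∑ c, ∑ d, ∑ e, thom c d e * phi9 a b c d e = 0 := by
  simp only [Fin.sum_univ_five]; decide
/-- on the pair `{0,2}`. -/
theorem phi9_pair2_long : ∀ a c : Fin 5, ∑ b, ∑ d, ∑ e, thom b d e * phi9 a b c d e = 0 := by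
  simp only [Fin.sum_univ_five]; decide
/-- on the pair `{0,3}`. -/
theorem phi9_pair3_long : ∀ a d : Fin 5, ∑ b, ∑ c, ∑ e, thom b c e * phi9 a b c d e = 0 := by
  simp only [Fin.sum_univ_five]; decide
/-- on the pair `{0,4}`. -/
theorem phi9_pair4_long : ∀ a e : Fin 5, ∑ b, ∑ c, ∑ d, thom b c d * phi9 a b c d e = 0 := by
  simp only [Fin.sum_univ_five]; decide

/-- `Φ₉` is supported on words with `v₀ ∈ {0,2}` and `v₁ = 0`; the pairings below are therefore the
sums over that 125-word window (the full `3125`-word sums, restricted to the support of `Φ₉`). -/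
theorem phi9_support : ∀ a b c d e : Fin 5, phi9 a b c d e ≠ 0 → (a = 0 ∨ a = 2) ∧ b = 0 := by decide

/-- `⟨Φ₉, A⁻⟩ = 3` (ODD: this is what survives reduction mod 2). -/
theorem phi9_pair_aMinus :
    ∑ c, ∑ d, ∑ e, (phi9 0 0 c d e * aMinus 0 0 c d e + phi9 2 0 c d e * aMinus 2 0 c d e) = 3 := by
  simp only [Fin.sum_univ_five]; decide
/-- `⟨Φ₉, A⁺⟩ = 3`. -/
theorem phi9_pair_aPlus :
    ∑ c, ∑ d, ∑ e, (phi9 0 0 c d e * aPlus 0 0 c d e + phi9 2 0 c d e * aPlus 2 0 c d e) = 3 := by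
  simp only [Fin.sum_univ_five]; decide
/-- `⟨Φ₉, P₅⟩ = 6`. -/
theorem phi9_pair_pat5 :
    ∑ c, ∑ d, ∑ e, (phi9 0 0 c d e * pat5 0 0 c d e + phi9 2 0 c d e * pat5 2 0 c d e) = 6 := by
  simp only [Fin.sum_univ_five]; decide
/-- `⟨Φ₉, D₅⟩ = 0`. -/
theorem phi9_pair_sgn5 :
    ∑ c, ∑ d, ∑ e, (phi9 0 0 c d e * sgn5 0 0 c d e + phi9 2 0 c d e * sgn5 2 0 c d e) = 0 := by
  simp only [Fin.sum_univ_five]; decide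

/-- values of `A⁻` and `P₅` on the nine words of the certificate (closed terms, by `decide`). -/
theorem aMinus_w1 : aMinus 2 0 1 3 4 = 0 := by decide
theorem aMinus_w2 : aMinus 2 0 1 4 3 = 1 := by decide
theorem aMinus_w3 : aMinus 2 0 3 1 4 = 1 := by decide
theorem aMinus_w4 : aMinus 2 0 3 4 1 = 0 := by decide
theorem aMinus_w5 : aMinus 2 0 4 1 3 = 0 := by decide
theorem aMinus_w6 : aMinus 2 0 4 3 1 = 1 := by decide
theorem aMinus_w7 : aMinus 0 0 1 1 4 = 0 := by decide
theorem aMinus_w8 : aMinus 0 0 1 4 1 = 0 := by decide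
theorem aMinus_w9 : aMinus 0 0 4 1 1 = 0 := by decide

theorem aPlus_w1 : aPlus 2 0 1 3 4 = 1 := by decide
theorem aPlus_w2 : aPlus 2 0 1 4 3 = 0 := by decide
theorem aPlus_w3 : aPlus 2 0 3 1 4 = 0 := by decide
theorem aPlus_w4 : aPlus 2 0 3 4 1 = 1 := by decide
theorem aPlus_w5 : aPlus 2 0 4 1 3 = 1 := by decide
theorem aPlus_w6 : aPlus 2 0 4 3 1 = 0 := by decide
theorem aPlus_w7 : aPlus 0 0 1 1 4 = 0 := by decide
theorem aPlus_w8 : aPlus 0 0 1 4 1 = 0 := by decide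
theorem aPlus_w9 : aPlus 0 0 4 1 1 = 0 := by decide

/-! ## §2 Consequences: sign-rigidity, dyadic height zero, no lift mod 4

A first-order deformation of the hub design `(θ + δθ', Ω + δY', ω₀ₖ + δu'_k, (θ∧ω) + δW'_k)` changes the
design by `δ·τ` with the TANGENT VECTOR
`τ = θ'⊗Ω + θ⊗Y' + Σ_k ±(u'_k ⊗ (θ∧ω) + ω₀ₖ ⊗ W'_k)`.  Pairing with `Φ₉` kills every `τ`
(§1) but not `A⁻`; only the nine words in the support of `Φ₉` are ever evaluated. -/

/-- SIGN-RIGIDITY: no integer tangent vector of the hub design equals `A⁻ = (P₅ − D₅)/2`, i.e. the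
design cannot be pushed to first order along the sign pencil `T_s = A⁺ + s·A⁻` away from `s = −1`. -/
theorem hub_sign_rigid (θ' : Fin 5 → ℤ) (Y' : Fin 5 → Fin 5 → Fin 5 → Fin 5 → ℤ)
    (u' : Fin 4 → Fin 5 → Fin 5 → ℤ) (W' : Fin 4 → Fin 5 → Fin 5 → Fin 5 → ℤ) :
    ¬ ∀ a b c d e : Fin 5,
      θ' a * Om b c d e + th a * Y' b c d e
        + (u' 0 a b * thom c d e + om a b * W' 0 c d e)
        - (u' 1 a c * thom b d e + om a c * W' 1 b d e)
        + (u' 2 a d * thom b c e + om a d * W' 2 b c e)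
        - (u' 3 a e * thom b c d + om a e * W' 3 b c d) = aMinus a b c d e := by
  intro h
  have h1 := h 2 0 1 3 4
  have h2 := h 2 0 1 4 3
  have h3 := h 2 0 3 1 4
  have h4 := h 2 0 3 4 1
  have h5 := h 2 0 4 1 3
  have h6 := h 2 0 4 3 1
  have h7 := h 0 0 1 1 4
  have h8 := h 0 0 1 4 1
  have h9 := h 0 0 4 1 1
  simp only [aMinus_w1, aMinus_w2, aMinus_w3, aMinus_w4, aMinus_w5, aMinus_w6, aMinus_w7, aMinus_w8,
    aMinus_w9] at h1 h2 h3 h4 h5 h6 h7 h8 h9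
  simp [th, om, Om, thom] at h1 h2 h3 h4 h5 h6 h7 h8 h9
  omega

/-- DYADIC HEIGHT ZERO: no integer tangent vector is even congruent to `A⁻` modulo 2.  Equivalently
(expand `(x + 2x')(y + 2y') ≡ xy + 2(x'y + xy') (mod 4)`): the mod-2 reduction of the hub design — an
honest weight-72 design of `P₅ ≡ D₅` over `𝔽₂` — has no lift to a weight-72 design of `P₅` over `ℤ/4`;
see `hub_no_mod4_lift` for that form. -/
theorem hub_dyadic_height_zero (θ' : Fin 5 → ℤ) (Y' : Fin 5 → Fin 5 → Fin 5 → Fin 5 → ℤ)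
    (u' : Fin 4 → Fin 5 → Fin 5 → ℤ) (W' : Fin 4 → Fin 5 → Fin 5 → Fin 5 → ℤ) :
    ¬ ∀ a b c d e : Fin 5, ∃ q : ℤ,
      θ' a * Om b c d e + th a * Y' b c d e
        + (u' 0 a b * thom c d e + om a b * W' 0 c d e)
        - (u' 1 a c * thom b d e + om a c * W' 1 b d e)
        + (u' 2 a d * thom b c e + om a d * W' 2 b c e)
        - (u' 3 a e * thom b c d + om a e * W' 3 b c d) = aMinus a b c d e + 2 * q := by
  intro h
  obtain ⟨q1, h1⟩ := h 2 0 1 3 4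
  obtain ⟨q2, h2⟩ := h 2 0 1 4 3
  obtain ⟨q3, h3⟩ := h 2 0 3 1 4
  obtain ⟨q4, h4⟩ := h 2 0 3 4 1
  obtain ⟨q5, h5⟩ := h 2 0 4 1 3
  obtain ⟨q6, h6⟩ := h 2 0 4 3 1
  obtain ⟨q7, h7⟩ := h 0 0 1 1 4
  obtain ⟨q8, h8⟩ := h 0 0 1 4 1
  obtain ⟨q9, h9⟩ := h 0 0 4 1 1
  simp only [aMinus_w1, aMinus_w2, aMinus_w3, aMinus_w4, aMinus_w5, aMinus_w6, aMinus_w7, aMinus_w8,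
    aMinus_w9] at h1 h2 h3 h4 h5 h6 h7 h8 h9
  simp [th, om, Om, thom] at h1 h2 h3 h4 h5 h6 h7 h8 h9
  omega

/-- NO LIFT MOD 4 (headline).  Any integer split system on the hub configuration whose factors reduce
mod 2 to the hub design's (`θ + 2θ'`, `Ω + 2Y'`, `ω₀ₖ + 2u'_k`, `(θ∧ω) + 2W'_k`) multiplies out to
something `≢ P₅ (mod 4)` — although `P₅ ≡ D₅ (mod 2)`: the sign knife is a mod-4 phenomenon, and the
determinant's cheapest design does not survive it. -/
theorem hub_no_mod4_lift (θ' : Fin 5 → ℤ) (Y' : Fin 5 → Fin 5 → Fin 5 → Fin 5 → ℤ)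
    (u' : Fin 4 → Fin 5 → Fin 5 → ℤ) (W' : Fin 4 → Fin 5 → Fin 5 → Fin 5 → ℤ) :
    ¬ ∀ a b c d e : Fin 5, ∃ q : ℤ,
      (th a + 2 * θ' a) * (Om b c d e + 2 * Y' b c d e)
        + (om a b + 2 * u' 0 a b) * (thom c d e + 2 * W' 0 c d e)
        - (om a c + 2 * u' 1 a c) * (thom b d e + 2 * W' 1 b d e)
        + (om a d + 2 * u' 2 a d) * (thom b c e + 2 * W' 2 b c e)
        - (om a e + 2 * u' 3 a e) * (thom b c d + 2 * W' 3 b c d) = pat5 a b c d e + 4 * q := by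
  intro h
  apply hub_dyadic_height_zero θ' Y' u' W'
  intro a b c d e
  obtain ⟨q, hq⟩ := h a b c d e
  have H := hub_design a b c d e
  have E1 := pat5_eq_aPlus_add_aMinus a b c d e
  have E2 := sgn5_eq_aPlus_sub_aMinus a b c d e
  refine ⟨q - (θ' a * Y' b c d e + u' 0 a b * W' 0 c d e - u' 1 a c * W' 1 b d e
      + u' 2 a d * W' 2 b c e - u' 3 a e * W' 3 b c d), ?_⟩
  have h2 : 2 * (θ' a * Om b c d e + th a * Y' b c d e
        + (u' 0 a b * thom c d e + om a b * W' 0 c d e)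
        - (u' 1 a c * thom b d e + om a c * W' 1 b d e)
        + (u' 2 a d * thom b c e + om a d * W' 2 b c e)
        - (u' 3 a e * thom b c d + om a e * W' 3 b c d))
      = 2 * (aMinus a b c d e + 2 * (q - (θ' a * Y' b c d e + u' 0 a b * W' 0 c d e
          - u' 1 a c * W' 1 b d e + u' 2 a d * W' 2 b c e - u' 3 a e * W' 3 b c d))) := by
    linear_combination hq - H + E1 - E2
  exact Int.eq_of_mul_eq_mul_left (by norm_num) h2


/-- **THE PENCIL MEETS THE HUB CONFIGURATION ONLY AT `D₅`** (over `ℂ`, long factors arbitrary).  On the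
determinant's hub configuration — short factors `θ` on slot `0` and `ω(v₀,v_k)` on the pairs `0k` — the
only pencil member `T_s = A⁺ + s·A⁻` that ANY choice of long factors can write is `s = −1`, i.e. `D₅`
itself: pair the identity against the certificate `Φ₉` (`⟨Φ₉,T_s⟩ = 3 + 3s`, `Φ₉ ⊥ L(U_hub)`).  This is the
kernel form of «transport height 0» in its strongest (isolation) reading, and the first proved instance
of the card's K1 mechanism: a D-feasible configuration that misses `P₅` BECAUSE a functional vanishing on
`L(U)` separates the pencil. -/
theorem hub_configuration_pencil_only_D5 (s : ℂ) (Y : Fin 5 → Fin 5 → Fin 5 → Fin 5 → ℂ)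
    (W : Fin 4 → Fin 5 → Fin 5 → Fin 5 → ℂ)
    (h : ∀ a b c d e : Fin 5,
      (th a : ℂ) * Y b c d e + (om a b : ℂ) * W 0 c d e + (om a c : ℂ) * W 1 b d e
        + (om a d : ℂ) * W 2 b c e + (om a e : ℂ) * W 3 b c d
        = (aPlus a b c d e : ℂ) + s * (aMinus a b c d e : ℂ)) : s = -1 := by
  have h1 := h 2 0 1 3 4
  have h2 := h 2 0 1 4 3
  have h3 := h 2 0 3 1 4
  have h4 := h 2 0 3 4 1
  have h5 := h 2 0 4 1 3
  have h6 := h 2 0 4 3 1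
  have h7 := h 0 0 1 1 4
  have h8 := h 0 0 1 4 1
  have h9 := h 0 0 4 1 1
  simp only [aMinus_w1, aMinus_w2, aMinus_w3, aMinus_w4, aMinus_w5, aMinus_w6, aMinus_w7, aMinus_w8,
    aMinus_w9, aPlus_w1, aPlus_w2, aPlus_w3, aPlus_w4, aPlus_w5, aPlus_w6, aPlus_w7, aPlus_w8,
    aPlus_w9] at h1 h2 h3 h4 h5 h6 h7 h8 h9
  simp [th, om] at h1 h2 h3 h4 h5 h6 h7 h8 h9
  have key : (3 : ℂ) + 3 * s = 0 := by
    linear_combination -h1 - h2 - h3 - h4 - h5 - h6 + h7 + h8 + h9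
  have : s = -1 := by linear_combination key / 3
  exact this

/-- In particular NO long factors on the hub configuration write `P₅ = T₁` (the configuration is
D-feasible and misses `P₅`: the dichotomy's `A⁻ ∉ L(U_hub)` in kernel form) … -/
theorem hub_configuration_misses_P5 (Y : Fin 5 → Fin 5 → Fin 5 → Fin 5 → ℂ)
    (W : Fin 4 → Fin 5 → Fin 5 → Fin 5 → ℂ) :
    ¬ ∀ a b c d e : Fin 5,
      (th a : ℂ) * Y b c d e + (om a b : ℂ) * W 0 c d e + (om a c : ℂ) * W 1 b d e
        + (om a d : ℂ) * W 2 b c e + (om a e : ℂ) * W 3 b c d = (pat5 a b c d e : ℂ) := by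
  intro h
  have h' : ∀ a b c d e : Fin 5,
      (th a : ℂ) * Y b c d e + (om a b : ℂ) * W 0 c d e + (om a c : ℂ) * W 1 b d e
        + (om a d : ℂ) * W 2 b c e + (om a e : ℂ) * W 3 b c d
        = (aPlus a b c d e : ℂ) + 1 * (aMinus a b c d e : ℂ) := by
    intro a b c d e; rw [h, pat5_eq_aPlus_add_aMinus]; push_cast; ring
  have := hub_configuration_pencil_only_D5 1 Y W h'
  norm_num at this

/-- … nor `A⁺ = T₀`, nor `A⁻` (`= T_∞`; stated directly). -/
theorem hub_configuration_misses_aMinus (Y : Fin 5 → Fin 5 → Fin 5 → Fin 5 → ℂ)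
    (W : Fin 4 → Fin 5 → Fin 5 → Fin 5 → ℂ) :
    ¬ ∀ a b c d e : Fin 5,
      (th a : ℂ) * Y b c d e + (om a b : ℂ) * W 0 c d e + (om a c : ℂ) * W 1 b d e
        + (om a d : ℂ) * W 2 b c e + (om a e : ℂ) * W 3 b c d = (aMinus a b c d e : ℂ) := by
  intro h
  have h1 := h 2 0 1 3 4
  have h2 := h 2 0 1 4 3
  have h3 := h 2 0 3 1 4
  have h4 := h 2 0 3 4 1
  have h5 := h 2 0 4 1 3
  have h6 := h 2 0 4 3 1
  have h7 := h 0 0 1 1 4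
  have h8 := h 0 0 1 4 1
  have h9 := h 0 0 4 1 1
  simp only [aMinus_w1, aMinus_w2, aMinus_w3, aMinus_w4, aMinus_w5, aMinus_w6, aMinus_w7, aMinus_w8,
    aMinus_w9] at h1 h2 h3 h4 h5 h6 h7 h8 h9
  simp [th, om] at h1 h2 h3 h4 h5 h6 h7 h8 h9
  have key : (3 : ℂ) = 0 := by
    linear_combination -h1 - h2 - h3 - h4 - h5 - h6 + h7 + h8 + h9
  norm_num at key


/-! ### §2c The p629937 star border configuration is D-INFEASIBLE (two-word certificate)

The weight-108 border family of `LaplaceFiveBorder.laplaceOptimal_five_border` has short factors (slot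
pairs `01,01,01,02,02,03,03,04,04`) built from `E = 𝟙[(v₀,v_j) = (0,3)]`, `N = 𝟙[{v₀,v_j} = {1,3}]` scaled by
`ε⁻¹` and `M = 𝟙[{v₀,v_j} = {2,4}]`.  Whatever the long factors, such a configuration never writes `D₅`:
at the two words `(2,4,0,1,3)` and `(4,2,0,1,3)` only the `M ⊗ W₂` term on the pair `01` survives, with the
SAME unknown `W₂(0,1,3)`, while `D₅` takes opposite signs there.  (Certificate
`Ψ_B = 𝟙[(2,4,0,1,3)] − 𝟙[(4,2,0,1,3)] ⊥ L(U_B(ε))`, `⟨Ψ_B, D₅⟩ = −2`; the same two words show `A⁻ ∉ L(U_B(ε))`.)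
So the D-feasible sector K1 of the card does NOT contain the star border class — stated honestly there —
and the two obstructions of record (sign at the determinant's designs, border at `P₅`'s) live on
disjoint configurations. -/

/-- `E = 𝟙[(a,b) = (0,3)]` -/
def bE (a b : Fin 5) : ℂ := if a = 0 ∧ b = 3 then 1 else 0
/-- `N = 𝟙[{a,b} = {1,3}]` (ordered either way) -/
def bN (a b : Fin 5) : ℂ := if (a = 1 ∧ b = 3) ∨ (a = 3 ∧ b = 1) then 1 else 0
/-- `M = 𝟙[{a,b} = {2,4}]` -/
def bM (a b : Fin 5) : ℂ := if (a = 2 ∧ b = 4) ∨ (a = 4 ∧ b = 2) then 1 else 0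

theorem sgn5_w24013 : sgn5 2 4 0 1 3 = -1 := by decide
theorem sgn5_w42013 : sgn5 4 2 0 1 3 = 1 := by decide
theorem aMinus_w24013 : aMinus 2 4 0 1 3 = 1 := by decide
theorem aMinus_w42013 : aMinus 4 2 0 1 3 = 0 := by decide

/-- **The star border configuration `U_B(ε)` of p629937 is D-infeasible** — for EVERY `ε : ℂ` (short
factors verbatim from `LaplaceFiveBorder.laplaceOptimal_five_border`, long factors arbitrary functions of
the complementary letters). -/
theorem star_border_configuration_D_infeasible (ε : ℂ) (W : Fin 9 → Fin 5 → Fin 5 → Fin 5 → ℂ) :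
    ¬ ∀ a b c d e : Fin 5,
      (ε⁻¹ * bE a b) * W 0 c d e + (ε⁻¹ * bN a b) * W 1 c d e + bM a b * W 2 c d e
        + (ε⁻¹ * bE a c + bM a c) * W 3 b d e + (ε⁻¹ * bN a c + bM a c) * W 4 b d e
        + (ε⁻¹ * bE a d + bM a d) * W 5 b c e + (ε⁻¹ * bN a d + (-1) * bM a d) * W 6 b c e
        + (ε⁻¹ * bE a e - (1/2) * bM a e) * W 7 b c d + (ε⁻¹ * bN a e) * W 8 b c d
        = (sgn5 a b c d e : ℂ) := by
  intro h
  have h1 := h 2 4 0 1 3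
  have h2 := h 4 2 0 1 3
  simp only [sgn5_w24013, sgn5_w42013] at h1 h2
  simp [bE, bN, bM] at h1 h2
  rw [h1] at h2
  norm_num at h2

/-- … and it never writes `A⁻` either (same two words). -/
theorem star_border_configuration_misses_aMinus (ε : ℂ) (W : Fin 9 → Fin 5 → Fin 5 → Fin 5 → ℂ) :
    ¬ ∀ a b c d e : Fin 5,
      (ε⁻¹ * bE a b) * W 0 c d e + (ε⁻¹ * bN a b) * W 1 c d e + bM a b * W 2 c d e
        + (ε⁻¹ * bE a c + bM a c) * W 3 b d e + (ε⁻¹ * bN a c + bM a c) * W 4 b d e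
        + (ε⁻¹ * bE a d + bM a d) * W 5 b c e + (ε⁻¹ * bN a d + (-1) * bM a d) * W 6 b c e
        + (ε⁻¹ * bE a e - (1/2) * bM a e) * W 7 b c d + (ε⁻¹ * bN a e) * W 8 b c d
        = (aMinus a b c d e : ℂ) := by
  intro h
  have h1 := h 2 4 0 1 3
  have h2 := h 4 2 0 1 3
  simp only [aMinus_w24013, aMinus_w42013] at h1 h2
  simp [bE, bN, bM] at h1 h2
  rw [h1] at h2
  norm_num at h2

/-! ### §2d Two EXACT slice-free tail designs of `D₅` (weights 96 and 84) and their two-word certificate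
(after crit-3 g6 02:32:54Z: neg-2 g2's LM census reports `D₅` EXACT-CAND on `hub2222 = 2·01+2·02+2·03+2·04`;
here is the exact integer design, found by re-expanding the hub slice — no LM, entries in `{0, ±1}`.  The SAME two
designs were derived independently and simultaneously by crit-3 g6 (bus 02:46Z/02:47:06Z, probe
`probes/Idea9ExactDesigns.lean` sha16 0e36ecbe1a050b12: `design96_star`, `design84_sixTail`, by `decide`) — cited.)
* `hub2222_design`: `D₅ = Σ_k ± ( ω(v₀,v_k)⊗(θ∧ω) + [θ(v₀)e⁰(v_k)] ⊗ e^{123} )` — the slice `θ(v₀)·Ω(v₁..v₄)` of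
  the hub design, `Ω = ω∧ω/2 = e⁰∧e¹∧e²∧e³`, re-expanded by the shuffle formula (one term per slot `k`):
  profile `2·01+2·02+2·03+2·04` ⊂ `StarTail`, weight `8·12 = 96`, slice-free.
* `twohub84_design`: the same slice re-expanded with hub slot 1, `Ω(v₁..v₄) = Σ_{k≥2} ± ω(v₁,v_k)·ω(rest)`,
  `θ(v₀)` absorbed into the long factors: profile `01+02+03+04+12+13+14` ⊂ `SixTail`, weight `7·12 = 84`.
* Both CONFIGURATIONS (arbitrary long factors) meet the sign pencil only at `D₅` — two-word certificate
  `δ₍₂,₃,₀,₁,₄₎ + δ₍₃,₂,₀,₁,₄₎` (the two words differ by the letter transposition `(2 3)` seen only by the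
  ray-`01` short factor `ω`, `ω(2,3) = −ω(3,2)`; every other short factor vanishes on them) — so they are
  K1-instances nos. 2 and 3 (slice-free, exact): `δ = 1`, `P₅, A⁺, A⁻ ∉ L(U)`.  Computed besides
  (calc/hub2222.py, exact): `rank L(U₂₂₂₂) = 869/1000`, `rank 𝒯₂₂₂₂ = 1018` (first-order sign-rigid). -/

/-- `e⁰` (indicator of the letter `0`). -/
def e0 (x : Fin 5) : ℤ := if x = 0 then 1 else 0

/-- `e¹∧e²∧e³` on three letters. -/
def E123 (x y z : Fin 5) : ℤ :=
  if x = 0 ∨ y = 0 ∨ z = 0 ∨ x = 4 ∨ y = 4 ∨ z = 4 then 0 else sg x y * sg x z * sg y z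

/-- **EXACT slice-free star design of `D₅`, weight 96**, profile `2·01+2·02+2·03+2·04` (`StarTail` sub-profile). -/
theorem hub2222_design : ∀ a b c d e : Fin 5,
    (om a b * thom c d e + th a * e0 b * E123 c d e) - (om a c * thom b d e + th a * e0 c * E123 b d e)
      + (om a d * thom b c e + th a * e0 d * E123 b c e) - (om a e * thom b c d + th a * e0 e * E123 b c d)
      = sgn5 a b c d e := by decide

/-- **EXACT slice-free design of `D₅`, weight 84**, profile `01+02+03+04+12+13+14` (`SixTail` sub-profile). -/
theorem twohub84_design : ∀ a b c d e : Fin 5,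
    om a b * thom c d e - om a c * thom b d e + om a d * thom b c e - om a e * thom b c d
      + om b c * (th a * om d e) - om b d * (th a * om c e) + om b e * (th a * om c d)
      = sgn5 a b c d e := by decide

theorem aPlus_23014 : aPlus 2 3 0 1 4 = 1 := by decide
theorem aMinus_23014 : aMinus 2 3 0 1 4 = 0 := by decide
theorem aPlus_32014 : aPlus 3 2 0 1 4 = 0 := by decide
theorem aMinus_32014 : aMinus 3 2 0 1 4 = 1 := by decide

/-- The `2222` star CONFIGURATION (short factors `ω(v₀,v_k)` and `θ(v₀)e⁰(v_k)`, ARBITRARY long factors)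
meets the sign pencil `T_s = A⁺ + s·A⁻` only at `s = −1` (`D₅`): two-word certificate. -/
theorem hub2222_configuration_pencil_only_D5 (s : ℂ) (W : Fin 8 → Fin 5 → Fin 5 → Fin 5 → ℂ)
    (h : ∀ a b c d e : Fin 5,
      (om a b : ℂ) * W 0 c d e + (th a * e0 b : ℂ) * W 1 c d e + (om a c : ℂ) * W 2 b d e
        + (th a * e0 c : ℂ) * W 3 b d e + (om a d : ℂ) * W 4 b c e + (th a * e0 d : ℂ) * W 5 b c e
        + (om a e : ℂ) * W 6 b c d + (th a * e0 e : ℂ) * W 7 b c d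
        = (aPlus a b c d e : ℂ) + s * (aMinus a b c d e : ℂ)) : s = -1 := by
  have h1 := h 2 3 0 1 4
  have h2 := h 3 2 0 1 4
  simp [om, th, e0, aPlus_23014, aMinus_23014, aPlus_32014, aMinus_32014] at h1 h2
  linear_combination -(h1 + h2)

/-- … in particular it misses `P₅ = T₁` (a K1-instance: `δ = 1` by `hub2222_design`, `P₅ ∉ L(U₂₂₂₂)`) … -/
theorem hub2222_configuration_misses_P5 (W : Fin 8 → Fin 5 → Fin 5 → Fin 5 → ℂ) :
    ¬ ∀ a b c d e : Fin 5,
      (om a b : ℂ) * W 0 c d e + (th a * e0 b : ℂ) * W 1 c d e + (om a c : ℂ) * W 2 b d e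
        + (th a * e0 c : ℂ) * W 3 b d e + (om a d : ℂ) * W 4 b c e + (th a * e0 d : ℂ) * W 5 b c e
        + (om a e : ℂ) * W 6 b c d + (th a * e0 e : ℂ) * W 7 b c d = (pat5 a b c d e : ℂ) := by
  intro h
  have h' : ∀ a b c d e : Fin 5,
      (om a b : ℂ) * W 0 c d e + (th a * e0 b : ℂ) * W 1 c d e + (om a c : ℂ) * W 2 b d e
        + (th a * e0 c : ℂ) * W 3 b d e + (om a d : ℂ) * W 4 b c e + (th a * e0 d : ℂ) * W 5 b c e
        + (om a e : ℂ) * W 6 b c d + (th a * e0 e : ℂ) * W 7 b c d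
        = (aPlus a b c d e : ℂ) + 1 * (aMinus a b c d e : ℂ) := by
    intro a b c d e; rw [h, pat5_eq_aPlus_add_aMinus]; push_cast; ring
  have := hub2222_configuration_pencil_only_D5 1 W h'
  norm_num at this

/-- … and `A⁻` (`T_∞`, stated directly). -/
theorem hub2222_configuration_misses_aMinus (W : Fin 8 → Fin 5 → Fin 5 → Fin 5 → ℂ) :
    ¬ ∀ a b c d e : Fin 5,
      (om a b : ℂ) * W 0 c d e + (th a * e0 b : ℂ) * W 1 c d e + (om a c : ℂ) * W 2 b d e
        + (th a * e0 c : ℂ) * W 3 b d e + (om a d : ℂ) * W 4 b c e + (th a * e0 d : ℂ) * W 5 b c e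
        + (om a e : ℂ) * W 6 b c d + (th a * e0 e : ℂ) * W 7 b c d = (aMinus a b c d e : ℂ) := by
  intro h
  have h1 := h 2 3 0 1 4
  have h2 := h 3 2 0 1 4
  simp [om, th, e0, aMinus_23014, aMinus_32014] at h1 h2
  have h3 : (0 : ℂ) = 1 := by linear_combination h1 + h2
  norm_num at h3

/-- The `84` two-hub CONFIGURATION (short factors `ω(v₀,v_k)`, `k = 1..4`, `ω(v₁,v_k)`, `k = 2,3,4`, ARBITRARY
long factors) meets the sign pencil only at `D₅` (same two-word certificate). -/
theorem twohub84_configuration_pencil_only_D5 (s : ℂ) (W : Fin 7 → Fin 5 → Fin 5 → Fin 5 → ℂ)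
    (h : ∀ a b c d e : Fin 5,
      (om a b : ℂ) * W 0 c d e + (om a c : ℂ) * W 1 b d e + (om a d : ℂ) * W 2 b c e
        + (om a e : ℂ) * W 3 b c d + (om b c : ℂ) * W 4 a d e + (om b d : ℂ) * W 5 a c e
        + (om b e : ℂ) * W 6 a c d
        = (aPlus a b c d e : ℂ) + s * (aMinus a b c d e : ℂ)) : s = -1 := by
  have h1 := h 2 3 0 1 4
  have h2 := h 3 2 0 1 4
  simp [om, aPlus_23014, aMinus_23014, aPlus_32014, aMinus_32014] at h1 h2
  linear_combination -(h1 + h2)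

theorem twohub84_configuration_misses_P5 (W : Fin 7 → Fin 5 → Fin 5 → Fin 5 → ℂ) :
    ¬ ∀ a b c d e : Fin 5,
      (om a b : ℂ) * W 0 c d e + (om a c : ℂ) * W 1 b d e + (om a d : ℂ) * W 2 b c e
        + (om a e : ℂ) * W 3 b c d + (om b c : ℂ) * W 4 a d e + (om b d : ℂ) * W 5 a c e
        + (om b e : ℂ) * W 6 a c d = (pat5 a b c d e : ℂ) := by
  intro h
  have h' : ∀ a b c d e : Fin 5,
      (om a b : ℂ) * W 0 c d e + (om a c : ℂ) * W 1 b d e + (om a d : ℂ) * W 2 b c e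
        + (om a e : ℂ) * W 3 b c d + (om b c : ℂ) * W 4 a d e + (om b d : ℂ) * W 5 a c e
        + (om b e : ℂ) * W 6 a c d
        = (aPlus a b c d e : ℂ) + 1 * (aMinus a b c d e : ℂ) := by
    intro a b c d e; rw [h, pat5_eq_aPlus_add_aMinus]; push_cast; ring
  have := twohub84_configuration_pencil_only_D5 1 W h'
  norm_num at this

theorem twohub84_configuration_misses_aMinus (W : Fin 7 → Fin 5 → Fin 5 → Fin 5 → ℂ) :
    ¬ ∀ a b c d e : Fin 5,
      (om a b : ℂ) * W 0 c d e + (om a c : ℂ) * W 1 b d e + (om a d : ℂ) * W 2 b c e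
        + (om a e : ℂ) * W 3 b c d + (om b c : ℂ) * W 4 a d e + (om b d : ℂ) * W 5 a c e
        + (om b e : ℂ) * W 6 a c d = (aMinus a b c d e : ℂ) := by
  intro h
  have h1 := h 2 3 0 1 4
  have h2 := h 3 2 0 1 4
  simp [om, aMinus_23014, aMinus_32014] at h1 h2
  have h3 : (0 : ℂ) = 1 := by linear_combination h1 + h2
  norm_num at h3

/-! ### §2e The two exact tail designs are SIGN-RIGID mod 2 as well: DYADIC HEIGHT ZERO / NO MOD-4 LIFT
(rev 10).  The hub certificate `Φ₉` is `⊥ 𝒯₂₂₂₂` over `ℤ` too (the new `θ⊗e⁰ ⊗ e^{123}` generator families vanish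
identically on its nine words), and the `84` design has its own nine-word certificate `Ψ₉` = the six
permutations `(σ(0,1,2),3,4)` against the junk words `(0,1,0,1,4)`, `(1,0,0,1,4)`, `(0,0,1,1,4)`, with
`⟨Ψ₉,A⁻⟩ = 3` ODD (found by an 𝔽₂ kernel search, calc/f2cert.py + psi9.py; minimum odd weight 9 in the RREF
bases tried).  Hence NONE of the three exact integer designs of `D₅` (hub 72, star 96, two-hub 84) is the
mod-2 shadow of a design of `P₅` over `ℤ/4` on the same configuration: the «sign knife is a mod-4
phenomenon» statement of §2 now covers the slice-free tail designs (R2 of the card, honest/arithmetic —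
not a closed invariant). -/

theorem aMinus_v20134 : aMinus 2 0 1 3 4 = 0 := by decide
theorem aPlus_v20134 : aPlus 2 0 1 3 4 = 1 := by decide
theorem aMinus_v20143 : aMinus 2 0 1 4 3 = 1 := by decide
theorem aPlus_v20143 : aPlus 2 0 1 4 3 = 0 := by decide
theorem aMinus_v20314 : aMinus 2 0 3 1 4 = 1 := by decide
theorem aPlus_v20314 : aPlus 2 0 3 1 4 = 0 := by decide
theorem aMinus_v20341 : aMinus 2 0 3 4 1 = 0 := by decide
theorem aPlus_v20341 : aPlus 2 0 3 4 1 = 1 := by decide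
theorem aMinus_v20413 : aMinus 2 0 4 1 3 = 0 := by decide
theorem aPlus_v20413 : aPlus 2 0 4 1 3 = 1 := by decide
theorem aMinus_v20431 : aMinus 2 0 4 3 1 = 1 := by decide
theorem aPlus_v20431 : aPlus 2 0 4 3 1 = 0 := by decide
theorem aMinus_v00114 : aMinus 0 0 1 1 4 = 0 := by decide
theorem aPlus_v00114 : aPlus 0 0 1 1 4 = 0 := by decide
theorem aMinus_v00141 : aMinus 0 0 1 4 1 = 0 := by decide
theorem aPlus_v00141 : aPlus 0 0 1 4 1 = 0 := by decide
theorem aMinus_v00411 : aMinus 0 0 4 1 1 = 0 := by decide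
theorem aPlus_v00411 : aPlus 0 0 4 1 1 = 0 := by decide
theorem aMinus_v01234 : aMinus 0 1 2 3 4 = 0 := by decide
theorem aPlus_v01234 : aPlus 0 1 2 3 4 = 1 := by decide
theorem aMinus_v02134 : aMinus 0 2 1 3 4 = 1 := by decide
theorem aPlus_v02134 : aPlus 0 2 1 3 4 = 0 := by decide
theorem aMinus_v10234 : aMinus 1 0 2 3 4 = 1 := by decide
theorem aPlus_v10234 : aPlus 1 0 2 3 4 = 0 := by decide
theorem aMinus_v12034 : aMinus 1 2 0 3 4 = 0 := by decide
theorem aPlus_v12034 : aPlus 1 2 0 3 4 = 1 := by decide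
theorem aMinus_v21034 : aMinus 2 1 0 3 4 = 1 := by decide
theorem aPlus_v21034 : aPlus 2 1 0 3 4 = 0 := by decide
theorem aMinus_v01014 : aMinus 0 1 0 1 4 = 0 := by decide
theorem aPlus_v01014 : aPlus 0 1 0 1 4 = 0 := by decide
theorem aMinus_v10014 : aMinus 1 0 0 1 4 = 0 := by decide
theorem aPlus_v10014 : aPlus 1 0 0 1 4 = 0 := by decide

/-- tangent equation of the `2222` design ≡ `A⁻` (mod 2) is impossible: DYADIC HEIGHT ZERO (certificate `Φ₉`,
the hub's nine words, which is `⊥ 𝒯₂₂₂₂` over `ℤ` as well). -/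
theorem hub2222_dyadic_height_zero (u' t' : Fin 4 → Fin 5 → Fin 5 → ℤ)
    (W' Z' : Fin 4 → Fin 5 → Fin 5 → Fin 5 → ℤ) :
    ¬ ∀ a b c d e : Fin 5, ∃ q : ℤ,
      (u' 0 a b * thom c d e + om a b * W' 0 c d e + t' 0 a b * E123 c d e + th a * e0 b * Z' 0 c d e)
      - (u' 1 a c * thom b d e + om a c * W' 1 b d e + t' 1 a c * E123 b d e + th a * e0 c * Z' 1 b d e)
      + (u' 2 a d * thom b c e + om a d * W' 2 b c e + t' 2 a d * E123 b c e + th a * e0 d * Z' 2 b c e)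
      - (u' 3 a e * thom b c d + om a e * W' 3 b c d + t' 3 a e * E123 b c d + th a * e0 e * Z' 3 b c d)
        = aMinus a b c d e + 2 * q := by
  intro h
  obtain ⟨q1, h1⟩ := h 2 0 1 3 4
  obtain ⟨q2, h2⟩ := h 2 0 1 4 3
  obtain ⟨q3, h3⟩ := h 2 0 3 1 4
  obtain ⟨q4, h4⟩ := h 2 0 3 4 1
  obtain ⟨q5, h5⟩ := h 2 0 4 1 3
  obtain ⟨q6, h6⟩ := h 2 0 4 3 1
  obtain ⟨q7, h7⟩ := h 0 0 1 1 4
  obtain ⟨q8, h8⟩ := h 0 0 1 4 1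
  obtain ⟨q9, h9⟩ := h 0 0 4 1 1
  simp only [aMinus_v20134, aMinus_v20143, aMinus_v20314, aMinus_v20341, aMinus_v20413, aMinus_v20431, aMinus_v00114, aMinus_v00141, aMinus_v00411] at h1 h2 h3 h4 h5 h6 h7 h8 h9
  simp [th, om, thom, e0, E123] at h1 h2 h3 h4 h5 h6 h7 h8 h9
  omega

/-- NO MOD-4 LIFT of `P₅` from the `2222` design. -/
theorem hub2222_no_mod4_lift (u' t' : Fin 4 → Fin 5 → Fin 5 → ℤ)
    (W' Z' : Fin 4 → Fin 5 → Fin 5 → Fin 5 → ℤ) :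
    ¬ ∀ a b c d e : Fin 5, ∃ q : ℤ,
      ((om a b + 2 * u' 0 a b) * (thom c d e + 2 * W' 0 c d e)
          + (th a * e0 b + 2 * t' 0 a b) * (E123 c d e + 2 * Z' 0 c d e))
      - ((om a c + 2 * u' 1 a c) * (thom b d e + 2 * W' 1 b d e)
          + (th a * e0 c + 2 * t' 1 a c) * (E123 b d e + 2 * Z' 1 b d e))
      + ((om a d + 2 * u' 2 a d) * (thom b c e + 2 * W' 2 b c e)
          + (th a * e0 d + 2 * t' 2 a d) * (E123 b c e + 2 * Z' 2 b c e))
      - ((om a e + 2 * u' 3 a e) * (thom b c d + 2 * W' 3 b c d)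
          + (th a * e0 e + 2 * t' 3 a e) * (E123 b c d + 2 * Z' 3 b c d))
        = pat5 a b c d e + 4 * q := by
  intro h
  apply hub2222_dyadic_height_zero u' t' W' Z'
  intro a b c d e
  obtain ⟨q, hq⟩ := h a b c d e
  have H := hub2222_design a b c d e
  have E1 := pat5_eq_aPlus_add_aMinus a b c d e
  have E2 := sgn5_eq_aPlus_sub_aMinus a b c d e
  refine ⟨q - ((u' 0 a b * W' 0 c d e + t' 0 a b * Z' 0 c d e) - (u' 1 a c * W' 1 b d e + t' 1 a c * Z' 1 b d e)
      + (u' 2 a d * W' 2 b c e + t' 2 a d * Z' 2 b c e) - (u' 3 a e * W' 3 b c d + t' 3 a e * Z' 3 b c d)), ?_⟩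
  have h2 : 2 * ((u' 0 a b * thom c d e + om a b * W' 0 c d e + t' 0 a b * E123 c d e + th a * e0 b * Z' 0 c d e)
      - (u' 1 a c * thom b d e + om a c * W' 1 b d e + t' 1 a c * E123 b d e + th a * e0 c * Z' 1 b d e)
      + (u' 2 a d * thom b c e + om a d * W' 2 b c e + t' 2 a d * E123 b c e + th a * e0 d * Z' 2 b c e)
      - (u' 3 a e * thom b c d + om a e * W' 3 b c d + t' 3 a e * E123 b c d + th a * e0 e * Z' 3 b c d))
      = 2 * (aMinus a b c d e + 2 * (q - ((u' 0 a b * W' 0 c d e + t' 0 a b * Z' 0 c d e)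
          - (u' 1 a c * W' 1 b d e + t' 1 a c * Z' 1 b d e) + (u' 2 a d * W' 2 b c e + t' 2 a d * Z' 2 b c e)
          - (u' 3 a e * W' 3 b c d + t' 3 a e * Z' 3 b c d)))) := by
    linear_combination hq - H + E1 - E2
  exact Int.eq_of_mul_eq_mul_left (by norm_num) h2

/-- DYADIC HEIGHT ZERO for the `84` design (certificate `Ψ₉`: the six permutations `(σ(0,1,2),3,4)` against
the three junk words `(0,1,0,1,4)`, `(1,0,0,1,4)`, `(0,0,1,1,4)`; `⟨Ψ₉,A⁻⟩ = 3`). -/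
theorem twohub84_dyadic_height_zero (u' : Fin 4 → Fin 5 → Fin 5 → ℤ) (W' : Fin 4 → Fin 5 → Fin 5 → Fin 5 → ℤ)
    (x' : Fin 3 → Fin 5 → Fin 5 → ℤ) (V' : Fin 3 → Fin 5 → Fin 5 → Fin 5 → ℤ) :
    ¬ ∀ a b c d e : Fin 5, ∃ q : ℤ,
      (u' 0 a b * thom c d e + om a b * W' 0 c d e) - (u' 1 a c * thom b d e + om a c * W' 1 b d e)
      + (u' 2 a d * thom b c e + om a d * W' 2 b c e) - (u' 3 a e * thom b c d + om a e * W' 3 b c d)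
      + (x' 0 b c * (th a * om d e) + om b c * V' 0 a d e) - (x' 1 b d * (th a * om c e) + om b d * V' 1 a c e)
      + (x' 2 b e * (th a * om c d) + om b e * V' 2 a c d)
        = aMinus a b c d e + 2 * q := by
  intro h
  obtain ⟨q1, h1⟩ := h 0 1 2 3 4
  obtain ⟨q2, h2⟩ := h 0 2 1 3 4
  obtain ⟨q3, h3⟩ := h 1 0 2 3 4
  obtain ⟨q4, h4⟩ := h 1 2 0 3 4
  obtain ⟨q5, h5⟩ := h 2 0 1 3 4
  obtain ⟨q6, h6⟩ := h 2 1 0 3 4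
  obtain ⟨q7, h7⟩ := h 0 1 0 1 4
  obtain ⟨q8, h8⟩ := h 1 0 0 1 4
  obtain ⟨q9, h9⟩ := h 0 0 1 1 4
  simp only [aMinus_v01234, aMinus_v02134, aMinus_v10234, aMinus_v12034, aMinus_v20134, aMinus_v21034, aMinus_v01014, aMinus_v10014, aMinus_v00114] at h1 h2 h3 h4 h5 h6 h7 h8 h9
  simp [th, om, thom] at h1 h2 h3 h4 h5 h6 h7 h8 h9
  omega

/-- NO MOD-4 LIFT of `P₅` from the `84` design. -/
theorem twohub84_no_mod4_lift (u' : Fin 4 → Fin 5 → Fin 5 → ℤ) (W' : Fin 4 → Fin 5 → Fin 5 → Fin 5 → ℤ)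
    (x' : Fin 3 → Fin 5 → Fin 5 → ℤ) (V' : Fin 3 → Fin 5 → Fin 5 → Fin 5 → ℤ) :
    ¬ ∀ a b c d e : Fin 5, ∃ q : ℤ,
      (om a b + 2 * u' 0 a b) * (thom c d e + 2 * W' 0 c d e) - (om a c + 2 * u' 1 a c) * (thom b d e + 2 * W' 1 b d e)
      + (om a d + 2 * u' 2 a d) * (thom b c e + 2 * W' 2 b c e) - (om a e + 2 * u' 3 a e) * (thom b c d + 2 * W' 3 b c d)
      + (om b c + 2 * x' 0 b c) * (th a * om d e + 2 * V' 0 a d e)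
      - (om b d + 2 * x' 1 b d) * (th a * om c e + 2 * V' 1 a c e)
      + (om b e + 2 * x' 2 b e) * (th a * om c d + 2 * V' 2 a c d)
        = pat5 a b c d e + 4 * q := by
  intro h
  apply twohub84_dyadic_height_zero u' W' x' V'
  intro a b c d e
  obtain ⟨q, hq⟩ := h a b c d e
  have H := twohub84_design a b c d e
  have E1 := pat5_eq_aPlus_add_aMinus a b c d e
  have E2 := sgn5_eq_aPlus_sub_aMinus a b c d e
  refine ⟨q - (u' 0 a b * W' 0 c d e - u' 1 a c * W' 1 b d e + u' 2 a d * W' 2 b c e - u' 3 a e * W' 3 b c d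
      + x' 0 b c * V' 0 a d e - x' 1 b d * V' 1 a c e + x' 2 b e * V' 2 a c d), ?_⟩
  have h2 : 2 * ((u' 0 a b * thom c d e + om a b * W' 0 c d e) - (u' 1 a c * thom b d e + om a c * W' 1 b d e)
      + (u' 2 a d * thom b c e + om a d * W' 2 b c e) - (u' 3 a e * thom b c d + om a e * W' 3 b c d)
      + (x' 0 b c * (th a * om d e) + om b c * V' 0 a d e) - (x' 1 b d * (th a * om c e) + om b d * V' 1 a c e)
      + (x' 2 b e * (th a * om c d) + om b e * V' 2 a c d))
      = 2 * (aMinus a b c d e + 2 * (q - (u' 0 a b * W' 0 c d e - u' 1 a c * W' 1 b d e + u' 2 a d * W' 2 b c e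
          - u' 3 a e * W' 3 b c d + x' 0 b c * V' 0 a d e - x' 1 b d * V' 1 a c e + x' 2 b e * V' 2 a c d))) := by
    linear_combination hq - H + E1 - E2
  exact Int.eq_of_mul_eq_mul_left (by norm_num) h2

/-! ## §3 The typed K1 (D-feasible sector) and the pencil dichotomy -/

/-- **K1 (crux of the card, rank 2): the D-FEASIBLE SECTOR of `LaplaceOptimalFive`.**  If a split
system `(T, S, u, wP)` of short-side profile writes `P₅` AND the same short factors `u` (same `T`, `S`)
also carry an honest design `(T, S, u, wD)` of the Levi-Civita pattern `D₅`, then its weight is `≥ 120`.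
Why it might fail: it is a sector of the crux, so only if the crux fails inside the sector; it is
strictly weaker than the crux (the p629937 star border configuration is D-infeasible, calc/border.py). -/
def DFeasibleLaplaceOptimalFive : Prop :=
  ∀ (N : ℕ) (T : Finset (Fin N)) (S : Fin N → Finset (Fin 5))
    (u wD wP : Fin N → (Fin 5 → Fin 5) → ℂ),
    (∀ t, ∀ v v' : Fin 5 → Fin 5, (∀ i ∈ S t, v i = v' i) → u t v = u t v') →
    (∀ t, ∀ v v' : Fin 5 → Fin 5, (∀ i, i ∉ S t → v i = v' i) → wD t v = wD t v') →
    (∀ t, ∀ v v' : Fin 5 → Fin 5, (∀ i, i ∉ S t → v i = v' i) → wP t v = wP t v') →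
    (∀ v : Fin 5 → Fin 5, (∑ t ∈ T, u t v * wD t v) = (sgn5 (v 0) (v 1) (v 2) (v 3) (v 4) : ℂ)) →
    (∀ v : Fin 5 → Fin 5, (∑ t ∈ T, u t v * wP t v) = if Function.Injective v then 1 else 0) →
    Nat.factorial 5 ≤ ∑ t ∈ T, (S t).card.factorial * (5 - (S t).card).factorial

/-- HONESTY: K1 is a consequence of the crux (drop the `D`-design), not a strengthening. -/
theorem dFeasible_of_laplaceOptimalFive
    (h : Summit.ValiantsHypothesis.ValiantsHypothesis.Theses.RigidityForcesSymmetry.LaplaceOptimalFive) :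
    DFeasibleLaplaceOptimalFive := by
  intro N T S u wD wP hu _hwD hwP _hD hP
  exact h N T S u wP hu hwP hP

/-- PENCIL DICHOTOMY (the algebra behind K1): on a D-feasible configuration, a design of `P₅` with the
same short factors is the same thing as a design of `2·A⁻ = P₅ − D₅` (subtract the long factors).
Stated with the integer tables cast to `ℂ`. -/
theorem pencil_dichotomy {N : ℕ} (T : Finset (Fin N)) (u wD wP : Fin N → (Fin 5 → Fin 5) → ℂ)
    (hD : ∀ v : Fin 5 → Fin 5, (∑ t ∈ T, u t v * wD t v) = (sgn5 (v 0) (v 1) (v 2) (v 3) (v 4) : ℂ))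
    (hP : ∀ v : Fin 5 → Fin 5, (∑ t ∈ T, u t v * wP t v) = (pat5 (v 0) (v 1) (v 2) (v 3) (v 4) : ℂ)) :
    ∀ v : Fin 5 → Fin 5,
      (∑ t ∈ T, u t v * (wP t v - wD t v)) = 2 * (aMinus (v 0) (v 1) (v 2) (v 3) (v 4) : ℂ) := by
  intro v
  have h1 := hD v
  have h2 := hP v
  have h3 := pat5_eq_aPlus_add_aMinus (v 0) (v 1) (v 2) (v 3) (v 4)
  have h4 := sgn5_eq_aPlus_sub_aMinus (v 0) (v 1) (v 2) (v 3) (v 4)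
  have h5 : (∑ t ∈ T, u t v * (wP t v - wD t v))
      = (∑ t ∈ T, u t v * wP t v) - ∑ t ∈ T, u t v * wD t v := by
    rw [← Finset.sum_sub_distrib]; refine Finset.sum_congr rfl ?_; intro t _; ring
  rw [h5, h1, h2, h3, h4]; push_cast; ring

/-- Converse bookkeeping: a design of `D₅` plus a design of `2·A⁻` on the same short factors is a design
of `P₅` (so on D-feasible configurations `P₅ ∈ L(U) ⟺ A⁻ ∈ L(U)`). -/
theorem pencil_dichotomy_converse {N : ℕ} (T : Finset (Fin N)) (u wD wA : Fin N → (Fin 5 → Fin 5) → ℂ)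
    (hD : ∀ v : Fin 5 → Fin 5, (∑ t ∈ T, u t v * wD t v) = (sgn5 (v 0) (v 1) (v 2) (v 3) (v 4) : ℂ))
    (hA : ∀ v : Fin 5 → Fin 5,
      (∑ t ∈ T, u t v * wA t v) = 2 * (aMinus (v 0) (v 1) (v 2) (v 3) (v 4) : ℂ)) :
    ∀ v : Fin 5 → Fin 5,
      (∑ t ∈ T, u t v * (wD t v + wA t v)) = (pat5 (v 0) (v 1) (v 2) (v 3) (v 4) : ℂ) := by
  intro v
  have h1 := hD v
  have h2 := hA v
  have h3 := pat5_eq_aPlus_add_aMinus (v 0) (v 1) (v 2) (v 3) (v 4)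
  have h4 := sgn5_eq_aPlus_sub_aMinus (v 0) (v 1) (v 2) (v 3) (v 4)
  have h5 : (∑ t ∈ T, u t v * (wD t v + wA t v))
      = (∑ t ∈ T, u t v * wD t v) + ∑ t ∈ T, u t v * wA t v := by
    rw [← Finset.sum_add_distrib]; refine Finset.sum_congr rfl ?_; intro t _; ring
  rw [h5, h1, h2, h3, h4]; push_cast; ring

/-! ## §4 Design algebra in `LaplaceOptimal`'s data format and the PENCIL INEQUALITIES

Honest split designs can be CONCATENATED (design of `F₁` on `Fin N₁` + design of `F₂` on `Fin N₂` ↦ design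
of `F₁ + F₂` on `Fin (N₁ + N₂)`, weights add), RELABELLED (`v ↦ g ∘ v` on the letters; same slots, same
weight) and RESCALED.  With `P₅ = A⁺ + A⁻`, `A⁺ = A⁻ ∘ sw` and `T_s + T_{2−s} = 2P₅` this turns
`LaplaceOptimalFive` into NECESSARY CONDITIONS on tensors other than `P₅` — the card's falsifiers F0:
`w(A⁻) ≥ 60` (`laplaceOptimalFive_weight_aMinus`), `w(T_s) + w(T_{2−s}) ≥ 120`
(`laplaceOptimalFive_weight_pencil_pair`) and, using the determinant's weight-72 design `sign_five_cheap`
(tree), `w(T₃) ≥ 48` for `T₃ = A⁺ + 3A⁻ = 2P₅ − D₅` (`laplaceOptimalFive_weight_T3`).  Contrapositively: ONE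
honest design of `A⁻` of weight `≤ 48`, or of `T₃` of weight `≤ 36`, refutes the crux in kernel. -/

section DesignAlgebra

/-- `pat5` vanishes as soon as two letters coincide (kernel `decide`, curried letters). -/
theorem pat5_eq_zero_of_eq : ∀ a b c d e : Fin 5,
    (a = b ∨ a = c ∨ a = d ∨ a = e ∨ b = c ∨ b = d ∨ b = e ∨ c = d ∨ c = e ∨ d = e) →
    pat5 a b c d e = 0 := by
  decide

theorem pat5_of_not_injective (v : Fin 5 → Fin 5) (hv : ¬ Function.Injective v) :
    pat5 (v 0) (v 1) (v 2) (v 3) (v 4) = 0 := by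
  apply pat5_eq_zero_of_eq
  by_contra h
  push Not at h
  obtain ⟨h01, h02, h03, h04, h12, h13, h14, h23, h24, h34⟩ := h
  apply hv
  intro i j hij
  fin_cases i <;> fin_cases j <;> first | rfl | (exfalso; simp_all)

theorem pat5_of_injective (v : Fin 5 → Fin 5) (hv : Function.Injective v) :
    pat5 (v 0) (v 1) (v 2) (v 3) (v 4) = 1 := by
  have h : ∀ i j : Fin 5, i ≠ j → v i ≠ v j := fun i j hij e => hij (hv e)
  unfold pat5
  rw [if_pos]
  exact ⟨h 0 1 (by decide), h 0 2 (by decide), h 0 3 (by decide), h 0 4 (by decide), h 1 2 (by decide),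
    h 1 3 (by decide), h 1 4 (by decide), h 2 3 (by decide), h 2 4 (by decide), h 3 4 (by decide)⟩

/-- `pat5` IS the injectivity indicator of `LaplaceOptimal 5`'s target. -/
theorem pat5_indicator (v : Fin 5 → Fin 5) :
    ((pat5 (v 0) (v 1) (v 2) (v 3) (v 4) : ℤ) : ℂ) = if Function.Injective v then 1 else 0 := by
  by_cases hv : Function.Injective v
  · rw [if_pos hv, pat5_of_injective v hv]; simp
  · rw [if_neg hv, pat5_of_not_injective v hv]; simp

/-- `sgn5` is the inline Levi-Civita product used as the target of `SignPatternCheap.sign_five_cheap`. -/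
theorem sgn5_inline (v : Fin 5 → Fin 5) :
    sgn5 (v 0) (v 1) (v 2) (v 3) (v 4)
      = (if v 0 < v 1 then (1:ℤ) else if v 1 < v 0 then (-1:ℤ) else 0) * (if v 0 < v 2 then (1:ℤ) else if v 2 < v 0 then (-1:ℤ) else 0) * (if v 0 < v 3 then (1:ℤ) else if v 3 < v 0 then (-1:ℤ) else 0) * (if v 0 < v 4 then (1:ℤ) else if v 4 < v 0 then (-1:ℤ) else 0) * (if v 1 < v 2 then (1:ℤ) else if v 2 < v 1 then (-1:ℤ) else 0) * (if v 1 < v 3 then (1:ℤ) else if v 3 < v 1 then (-1:ℤ) else 0) * (if v 1 < v 4 then (1:ℤ) else if v 4 < v 1 then (-1:ℤ) else 0) * (if v 2 < v 3 then (1:ℤ) else if v 3 < v 2 then (-1:ℤ) else 0) * (if v 2 < v 4 then (1:ℤ) else if v 4 < v 2 then (-1:ℤ) else 0) * (if v 3 < v 4 then (1:ℤ) else if v 4 < v 3 then (-1:ℤ) else 0) := by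
  rfl

variable {N₁ N₂ : ℕ}

/-- Concatenated term set on `Fin (N₁ + N₂)`. -/
def catT (T₁ : Finset (Fin N₁)) (T₂ : Finset (Fin N₂)) : Finset (Fin (N₁ + N₂)) :=
  T₁.map (Fin.castAddEmb N₂) ∪ T₂.map (Fin.natAddEmb N₁)

theorem disjoint_catT (T₁ : Finset (Fin N₁)) (T₂ : Finset (Fin N₂)) :
    Disjoint (T₁.map (Fin.castAddEmb N₂)) (T₂.map (Fin.natAddEmb N₁)) := by
  rw [Finset.disjoint_left]
  intro a ha hb
  rw [Finset.mem_map] at ha hb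
  obtain ⟨i, -, rfl⟩ := ha
  obtain ⟨j, -, hj⟩ := hb
  have h1 := congrArg Fin.val hj
  have h2 := i.isLt
  simp at h1
  omega

theorem sum_catT {M : Type*} [AddCommMonoid M] (T₁ : Finset (Fin N₁)) (T₂ : Finset (Fin N₂))
    (f : Fin (N₁ + N₂) → M) :
    (∑ t ∈ catT T₁ T₂, f t) = (∑ t ∈ T₁, f (Fin.castAdd N₂ t)) + ∑ t ∈ T₂, f (Fin.natAdd N₁ t) := by
  rw [catT, Finset.sum_union (disjoint_catT T₁ T₂), Finset.sum_map, Finset.sum_map]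
  rfl

/-- CONCATENATION keeps locality of the short factors … -/
theorem cat_local (S₁ : Fin N₁ → Finset (Fin 5)) (S₂ : Fin N₂ → Finset (Fin 5))
    (u₁ : Fin N₁ → (Fin 5 → Fin 5) → ℂ) (u₂ : Fin N₂ → (Fin 5 → Fin 5) → ℂ)
    (hu₁ : ∀ t, ∀ v v' : Fin 5 → Fin 5, (∀ i ∈ S₁ t, v i = v' i) → u₁ t v = u₁ t v')
    (hu₂ : ∀ t, ∀ v v' : Fin 5 → Fin 5, (∀ i ∈ S₂ t, v i = v' i) → u₂ t v = u₂ t v') :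
    ∀ t, ∀ v v' : Fin 5 → Fin 5, (∀ i ∈ Fin.append S₁ S₂ t, v i = v' i) →
      Fin.append u₁ u₂ t v = Fin.append u₁ u₂ t v' := by
  intro t v v' h
  cases t using Fin.addCases with
  | left i => simp only [Fin.append_left] at h ⊢; exact hu₁ i v v' h
  | right j => simp only [Fin.append_right] at h ⊢; exact hu₂ j v v' h

/-- … and co-locality of the long factors. -/
theorem cat_colocal (S₁ : Fin N₁ → Finset (Fin 5)) (S₂ : Fin N₂ → Finset (Fin 5))
    (w₁ : Fin N₁ → (Fin 5 → Fin 5) → ℂ) (w₂ : Fin N₂ → (Fin 5 → Fin 5) → ℂ)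
    (hw₁ : ∀ t, ∀ v v' : Fin 5 → Fin 5, (∀ i, i ∉ S₁ t → v i = v' i) → w₁ t v = w₁ t v')
    (hw₂ : ∀ t, ∀ v v' : Fin 5 → Fin 5, (∀ i, i ∉ S₂ t → v i = v' i) → w₂ t v = w₂ t v') :
    ∀ t, ∀ v v' : Fin 5 → Fin 5, (∀ i, i ∉ Fin.append S₁ S₂ t → v i = v' i) →
      Fin.append w₁ w₂ t v = Fin.append w₁ w₂ t v' := by
  intro t v v' h
  cases t using Fin.addCases with
  | left i => simp only [Fin.append_left] at h ⊢; exact hw₁ i v v' h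
  | right j => simp only [Fin.append_right] at h ⊢; exact hw₂ j v v' h

/-- The concatenation writes the SUM of the two targets. -/
theorem cat_sum (T₁ : Finset (Fin N₁)) (T₂ : Finset (Fin N₂))
    (u₁ w₁ : Fin N₁ → (Fin 5 → Fin 5) → ℂ) (u₂ w₂ : Fin N₂ → (Fin 5 → Fin 5) → ℂ)
    (F₁ F₂ : (Fin 5 → Fin 5) → ℂ)
    (h₁ : ∀ v, (∑ t ∈ T₁, u₁ t v * w₁ t v) = F₁ v) (h₂ : ∀ v, (∑ t ∈ T₂, u₂ t v * w₂ t v) = F₂ v) :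
    ∀ v, (∑ t ∈ catT T₁ T₂, Fin.append u₁ u₂ t v * Fin.append w₁ w₂ t v) = F₁ v + F₂ v := by
  intro v
  rw [sum_catT]
  simp only [Fin.append_left, Fin.append_right]
  rw [h₁ v, h₂ v]

/-- Weights add under concatenation. -/
theorem cat_weight (T₁ : Finset (Fin N₁)) (T₂ : Finset (Fin N₂))
    (S₁ : Fin N₁ → Finset (Fin 5)) (S₂ : Fin N₂ → Finset (Fin 5)) :
    (∑ t ∈ catT T₁ T₂, (Fin.append S₁ S₂ t).card.factorial * (5 - (Fin.append S₁ S₂ t).card).factorial)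
      = (∑ t ∈ T₁, (S₁ t).card.factorial * (5 - (S₁ t).card).factorial)
        + ∑ t ∈ T₂, (S₂ t).card.factorial * (5 - (S₂ t).card).factorial := by
  rw [sum_catT]
  simp only [Fin.append_left, Fin.append_right]

/-- RELABELLING the letters (`v ↦ g ∘ v`) keeps locality. -/
theorem relabel_local {N : ℕ} (S : Fin N → Finset (Fin 5)) (u : Fin N → (Fin 5 → Fin 5) → ℂ)
    (g : Fin 5 → Fin 5)
    (hu : ∀ t, ∀ v v' : Fin 5 → Fin 5, (∀ i ∈ S t, v i = v' i) → u t v = u t v') :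
    ∀ t, ∀ v v' : Fin 5 → Fin 5, (∀ i ∈ S t, v i = v' i) → u t (g ∘ v) = u t (g ∘ v') := by
  intro t v v' h
  exact hu t (g ∘ v) (g ∘ v') (fun i hi => by simp only [Function.comp_apply, h i hi])

theorem relabel_colocal {N : ℕ} (S : Fin N → Finset (Fin 5)) (w : Fin N → (Fin 5 → Fin 5) → ℂ)
    (g : Fin 5 → Fin 5)
    (hw : ∀ t, ∀ v v' : Fin 5 → Fin 5, (∀ i, i ∉ S t → v i = v' i) → w t v = w t v') :
    ∀ t, ∀ v v' : Fin 5 → Fin 5, (∀ i, i ∉ S t → v i = v' i) → w t (g ∘ v) = w t (g ∘ v') := by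
  intro t v v' h
  exact hw t (g ∘ v) (g ∘ v') (fun i hi => by simp only [Function.comp_apply, h i hi])

/-- RESCALING the short factors keeps locality. -/
theorem scale_local {N : ℕ} (S : Fin N → Finset (Fin 5)) (u : Fin N → (Fin 5 → Fin 5) → ℂ) (c : ℂ)
    (hu : ∀ t, ∀ v v' : Fin 5 → Fin 5, (∀ i ∈ S t, v i = v' i) → u t v = u t v') :
    ∀ t, ∀ v v' : Fin 5 → Fin 5, (∀ i ∈ S t, v i = v' i) → c * u t v = c * u t v' := by
  intro t v v' h
  rw [hu t v v' h]

end DesignAlgebra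

section PencilInequalities

open Summit.ValiantsHypothesis.ValiantsHypothesis.Theses.RigidityForcesSymmetry (LaplaceOptimalFive)

/-- **PENCIL INEQUALITY 1: `LaplaceOptimalFive ⟹ w(A⁻) ≥ 60`.**  An honest split design of the
odd-permutation indicator `A⁻` of weight `W` doubles (second copy relabelled by the transposition `sw`,
which turns it into a design of `A⁺`) to a design of `P₅ = A⁺ + A⁻` of weight `2W`.  FALSIFIER F0 of the
card: a design of `A⁻` of weight `≤ 48` refutes the crux. -/
theorem laplaceOptimalFive_weight_aMinus (h : LaplaceOptimalFive) :
    ∀ (N : ℕ) (T : Finset (Fin N)) (S : Fin N → Finset (Fin 5)) (u w : Fin N → (Fin 5 → Fin 5) → ℂ),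
      (∀ t, ∀ v v' : Fin 5 → Fin 5, (∀ i ∈ S t, v i = v' i) → u t v = u t v') →
      (∀ t, ∀ v v' : Fin 5 → Fin 5, (∀ i, i ∉ S t → v i = v' i) → w t v = w t v') →
      (∀ v : Fin 5 → Fin 5, (∑ t ∈ T, u t v * w t v) = (aMinus (v 0) (v 1) (v 2) (v 3) (v 4) : ℂ)) →
      60 ≤ ∑ t ∈ T, (S t).card.factorial * (5 - (S t).card).factorial := by
  intro N T S u w hu hw hA
  have hA' : ∀ v : Fin 5 → Fin 5, (∑ t ∈ T, (fun t v => u t (sw ∘ v)) t v * (fun t v => w t (sw ∘ v)) t v)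
      = (aPlus (v 0) (v 1) (v 2) (v 3) (v 4) : ℂ) := by
    intro v
    simp only []
    rw [hA (sw ∘ v)]
    simp only [Function.comp_apply]
    rw [aPlus_eq_aMinus_sw]
  have hsum := cat_sum T T u w (fun t v => u t (sw ∘ v)) (fun t v => w t (sw ∘ v)) _ _ hA hA'
  have hP : ∀ v : Fin 5 → Fin 5,
      (∑ t ∈ catT T T, Fin.append u (fun t v => u t (sw ∘ v)) t v * Fin.append w (fun t v => w t (sw ∘ v)) t v)
        = if Function.Injective v then 1 else 0 := by
    intro v
    rw [hsum v, ← pat5_indicator v, pat5_eq_aPlus_add_aMinus]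
    push_cast; ring
  have key := h (N + N) (catT T T) (Fin.append S S) _ _
    (cat_local S S u _ hu (relabel_local S u sw hu))
    (cat_colocal S S w _ hw (relabel_colocal S w sw hw)) hP
  rw [cat_weight] at key
  have h120 : Nat.factorial 5 = 120 := by decide
  omega

/-- **PENCIL INEQUALITY 2: `LaplaceOptimalFive ⟹ w(T_s) + w(T_{2−s}) ≥ 120`** for every `s : ℂ`, where
`T_s = A⁺ + s·A⁻` (`T_s + T_{2−s} = 2P₅`; halve the short factors). -/
theorem laplaceOptimalFive_weight_pencil_pair (h : LaplaceOptimalFive) (s : ℂ) :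
    ∀ (N₁ : ℕ) (T₁ : Finset (Fin N₁)) (S₁ : Fin N₁ → Finset (Fin 5)) (u₁ w₁ : Fin N₁ → (Fin 5 → Fin 5) → ℂ)
      (N₂ : ℕ) (T₂ : Finset (Fin N₂)) (S₂ : Fin N₂ → Finset (Fin 5)) (u₂ w₂ : Fin N₂ → (Fin 5 → Fin 5) → ℂ),
      (∀ t, ∀ v v' : Fin 5 → Fin 5, (∀ i ∈ S₁ t, v i = v' i) → u₁ t v = u₁ t v') →
      (∀ t, ∀ v v' : Fin 5 → Fin 5, (∀ i, i ∉ S₁ t → v i = v' i) → w₁ t v = w₁ t v') →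
      (∀ v : Fin 5 → Fin 5, (∑ t ∈ T₁, u₁ t v * w₁ t v)
        = (aPlus (v 0) (v 1) (v 2) (v 3) (v 4) : ℂ) + s * (aMinus (v 0) (v 1) (v 2) (v 3) (v 4) : ℂ)) →
      (∀ t, ∀ v v' : Fin 5 → Fin 5, (∀ i ∈ S₂ t, v i = v' i) → u₂ t v = u₂ t v') →
      (∀ t, ∀ v v' : Fin 5 → Fin 5, (∀ i, i ∉ S₂ t → v i = v' i) → w₂ t v = w₂ t v') →
      (∀ v : Fin 5 → Fin 5, (∑ t ∈ T₂, u₂ t v * w₂ t v)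
        = (aPlus (v 0) (v 1) (v 2) (v 3) (v 4) : ℂ) + (2 - s) * (aMinus (v 0) (v 1) (v 2) (v 3) (v 4) : ℂ)) →
      120 ≤ (∑ t ∈ T₁, (S₁ t).card.factorial * (5 - (S₁ t).card).factorial)
              + ∑ t ∈ T₂, (S₂ t).card.factorial * (5 - (S₂ t).card).factorial := by
  intro N₁ T₁ S₁ u₁ w₁ N₂ T₂ S₂ u₂ w₂ hu₁ hw₁ h₁ hu₂ hw₂ h₂
  -- halve the short factors of both systems, then concatenate
  have h₁' : ∀ v : Fin 5 → Fin 5, (∑ t ∈ T₁, (fun t v => (1/2 : ℂ) * u₁ t v) t v * w₁ t v)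
      = (1/2 : ℂ) * ((aPlus (v 0) (v 1) (v 2) (v 3) (v 4) : ℂ) + s * (aMinus (v 0) (v 1) (v 2) (v 3) (v 4) : ℂ)) := by
    intro v; rw [← h₁ v, Finset.mul_sum]; refine Finset.sum_congr rfl ?_; intro t _; simp only []; ring
  have h₂' : ∀ v : Fin 5 → Fin 5, (∑ t ∈ T₂, (fun t v => (1/2 : ℂ) * u₂ t v) t v * w₂ t v)
      = (1/2 : ℂ) * ((aPlus (v 0) (v 1) (v 2) (v 3) (v 4) : ℂ) + (2 - s) * (aMinus (v 0) (v 1) (v 2) (v 3) (v 4) : ℂ)) := by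
    intro v; rw [← h₂ v, Finset.mul_sum]; refine Finset.sum_congr rfl ?_; intro t _; simp only []; ring
  have hsum := cat_sum T₁ T₂ _ w₁ _ w₂ _ _ h₁' h₂'
  have hP : ∀ v : Fin 5 → Fin 5,
      (∑ t ∈ catT T₁ T₂, Fin.append (fun t v => (1/2 : ℂ) * u₁ t v) (fun t v => (1/2 : ℂ) * u₂ t v) t v
          * Fin.append w₁ w₂ t v) = if Function.Injective v then 1 else 0 := by
    intro v
    rw [hsum v, ← pat5_indicator v, pat5_eq_aPlus_add_aMinus]
    push_cast; ring
  have key := h (N₁ + N₂) (catT T₁ T₂) (Fin.append S₁ S₂) _ _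
    (cat_local S₁ S₂ _ _ (scale_local S₁ u₁ (1/2) hu₁) (scale_local S₂ u₂ (1/2) hu₂))
    (cat_colocal S₁ S₂ w₁ w₂ hw₁ hw₂) hP
  rw [cat_weight] at key
  have h120 : Nat.factorial 5 = 120 := by decide
  omega

open Summit.ValiantsHypothesis.ValiantsHypothesis.Theorems.LaplaceOptimalFiveNegative.SignPatternCheap
  (sign_five_cheap)

/-- **PENCIL INEQUALITY 3: `LaplaceOptimalFive ⟹ w(T₃) ≥ 48`**, `T₃ = A⁺ + 3A⁻ = 2P₅ − D₅`, using the
determinant's honest weight-`72` design `sign_five_cheap` (tree) as the `s = −1` partner.  FALSIFIER F0′: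
a design of `T₃` of weight `≤ 36` refutes the crux. -/
theorem laplaceOptimalFive_weight_T3 (h : LaplaceOptimalFive) :
    ∀ (N : ℕ) (T : Finset (Fin N)) (S : Fin N → Finset (Fin 5)) (u w : Fin N → (Fin 5 → Fin 5) → ℂ),
      (∀ t, ∀ v v' : Fin 5 → Fin 5, (∀ i ∈ S t, v i = v' i) → u t v = u t v') →
      (∀ t, ∀ v v' : Fin 5 → Fin 5, (∀ i, i ∉ S t → v i = v' i) → w t v = w t v') →
      (∀ v : Fin 5 → Fin 5, (∑ t ∈ T, u t v * w t v)
        = (aPlus (v 0) (v 1) (v 2) (v 3) (v 4) : ℂ) + 3 * (aMinus (v 0) (v 1) (v 2) (v 3) (v 4) : ℂ)) →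
      48 ≤ ∑ t ∈ T, (S t).card.factorial * (5 - (S t).card).factorial := by
  intro N T S u w hu hw hT
  obtain ⟨TD, SD, uD, wD, huD, hwD, hwt, -, hidD⟩ := sign_five_cheap
  have hD : ∀ v : Fin 5 → Fin 5, (∑ t ∈ TD, uD t v * wD t v)
      = (aPlus (v 0) (v 1) (v 2) (v 3) (v 4) : ℂ) + (-1) * (aMinus (v 0) (v 1) (v 2) (v 3) (v 4) : ℂ) := by
    intro v
    rw [hidD v, ← sgn5_inline v, sgn5_eq_aPlus_sub_aMinus]
    push_cast; ring
  have hT' : ∀ v : Fin 5 → Fin 5, (∑ t ∈ T, u t v * w t v)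
      = (aPlus (v 0) (v 1) (v 2) (v 3) (v 4) : ℂ) + (2 - (-1)) * (aMinus (v 0) (v 1) (v 2) (v 3) (v 4) : ℂ) := by
    intro v; rw [hT v]; norm_num
  have key := laplaceOptimalFive_weight_pencil_pair h (-1) 5 TD SD uD wD N T S u w huD hwD hD hu hw hT'
  rw [hwt] at key
  omega

end PencilInequalities


/-! ## §5 Π2(a): the side-symmetric sector is D-infeasible — `δ` tied to the sectors of LINE shallow_collision
(crit-3 g6 verdict PRICE Π2, director-valiant R340 (2); kernel, no kit)

The one-line mechanism: pair a design `Σ_t u_t w_t = D₅` against `D₅` itself.  The total is `Σ_v D₅(v)² ≠ 0`,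
but a term whose two factors are both invariant under ONE slot transposition `(i j)` pairs to zero (the
involution `v ↦ v ∘ (i j)` flips `D₅` and fixes the term).  A slot-symmetric short factor on a side with `≥ 2`
slots supplies such a transposition, and co-locality makes ANY long factor invariant under it — so the
statement is about the CONFIGURATION (`δ = 0`), not about a particular system. -/

section PiTwo

open Summit.ValiantsHypothesis.ValiantsHypothesis.Theorems.RigidityForcesSymmetryRankRigidMinimalRepr.LaplaceFiveSectorSplit
  (SlotInvariantOn SideSymmetric IsSplitDecomposition laplaceWeight AsymLaplaceOptimalFive)

/-- the Levi-Civita pattern read on a word -/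
def sgnW (v : Fin 5 → Fin 5) : ℤ := sgn5 (v 0) (v 1) (v 2) (v 3) (v 4)

-- the ten letter transpositions flip the sign (3125 cases each, by `decide`)
theorem sgn5_sw01 : ∀ a b c d e : Fin 5, sgn5 b a c d e = -sgn5 a b c d e := by decide
theorem sgn5_sw02 : ∀ a b c d e : Fin 5, sgn5 c b a d e = -sgn5 a b c d e := by decide
theorem sgn5_sw03 : ∀ a b c d e : Fin 5, sgn5 d b c a e = -sgn5 a b c d e := by decide
theorem sgn5_sw04 : ∀ a b c d e : Fin 5, sgn5 e b c d a = -sgn5 a b c d e := by decide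
theorem sgn5_sw12 : ∀ a b c d e : Fin 5, sgn5 a c b d e = -sgn5 a b c d e := by decide
theorem sgn5_sw13 : ∀ a b c d e : Fin 5, sgn5 a d c b e = -sgn5 a b c d e := by decide
theorem sgn5_sw14 : ∀ a b c d e : Fin 5, sgn5 a e c d b = -sgn5 a b c d e := by decide
theorem sgn5_sw23 : ∀ a b c d e : Fin 5, sgn5 a b d c e = -sgn5 a b c d e := by decide
theorem sgn5_sw24 : ∀ a b c d e : Fin 5, sgn5 a b e d c = -sgn5 a b c d e := by decide
theorem sgn5_sw34 : ∀ a b c d e : Fin 5, sgn5 a b c e d = -sgn5 a b c d e := by decide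

/-- a slot transposition flips `sgnW` -/
theorem sgnW_comp_swap (i j : Fin 5) (hij : i ≠ j) (v : Fin 5 → Fin 5) :
    sgnW (v ∘ ⇑(Equiv.swap i j)) = -sgnW v := by
  fin_cases i <;> fin_cases j <;>
    first
    | exact absurd rfl hij
    | (simp only [sgnW, Function.comp_apply, Equiv.swap_apply_def]
       simp (config := { decide := true }) only [if_true, if_false, Fin.isValue]
       first
       | exact sgn5_sw01 _ _ _ _ _ | exact sgn5_sw02 _ _ _ _ _ | exact sgn5_sw03 _ _ _ _ _
       | exact sgn5_sw04 _ _ _ _ _ | exact sgn5_sw12 _ _ _ _ _ | exact sgn5_sw13 _ _ _ _ _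
       | exact sgn5_sw14 _ _ _ _ _ | exact sgn5_sw23 _ _ _ _ _ | exact sgn5_sw24 _ _ _ _ _
       | exact sgn5_sw34 _ _ _ _ _)

/-- precomposition with a slot permutation, as an equivalence of the word space -/
def precomp (τ : Equiv.Perm (Fin 5)) : (Fin 5 → Fin 5) ≃ (Fin 5 → Fin 5) where
  toFun v := v ∘ ⇑τ
  invFun v := v ∘ ⇑τ.symm
  left_inv v := by ext i; simp
  right_inv v := by ext i; simp

/-- ONE TERM: if both factors are invariant under the slot transposition `(i j)`, the term pairs to zero
against the Levi-Civita pattern (involution `v ↦ v ∘ (i j)`, characteristic `0`). -/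
theorem term_pairing_sgnW_zero (i j : Fin 5) (hij : i ≠ j) (u w : (Fin 5 → Fin 5) → ℂ)
    (hu : ∀ v, u (v ∘ ⇑(Equiv.swap i j)) = u v) (hw : ∀ v, w (v ∘ ⇑(Equiv.swap i j)) = w v) :
    ∑ v : Fin 5 → Fin 5, (sgnW v : ℂ) * (u v * w v) = 0 := by
  have h := (precomp (Equiv.swap i j)).sum_comp (fun v => (sgnW v : ℂ) * (u v * w v))
  simp only [precomp, Equiv.coe_fn_mk] at h
  simp_rw [sgnW_comp_swap i j hij, hu, hw] at h
  push_cast at h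
  have h3 : ∑ v : Fin 5 → Fin 5, -(sgnW v : ℂ) * (u v * w v) = -∑ v : Fin 5 → Fin 5, (sgnW v : ℂ) * (u v * w v) := by
    rw [← Finset.sum_neg_distrib]
    exact Finset.sum_congr rfl fun v _ => by ring
  linear_combination (-(1:ℂ)/2) * h + ((1:ℂ)/2) * h3

/-- `Σ_v D₅(v)² ≠ 0` (it is `120`; we only need one nonzero square). -/
theorem sum_sgnW_sq_ne_zero : ∑ v : Fin 5 → Fin 5, (sgnW v : ℂ) * (sgnW v : ℂ) ≠ 0 := by
  have hint : (0 : ℤ) < ∑ v : Fin 5 → Fin 5, sgnW v * sgnW v := by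
    have h1 : sgnW id * sgnW id ≤ ∑ v : Fin 5 → Fin 5, sgnW v * sgnW v :=
      Finset.single_le_sum (f := fun v => sgnW v * sgnW v) (fun v _ => mul_self_nonneg (sgnW v)) (Finset.mem_univ id)
    have h0 : sgnW id * sgnW id = 1 := by decide
    omega
  have hne : (∑ v : Fin 5 → Fin 5, sgnW v * sgnW v : ℤ) ≠ 0 := ne_of_gt hint
  exact_mod_cast hne

/-- **Π2(a), configuration level (the `u`-only, slice-free form).**  If every term of `T` has a short side
with at least two slots and a short factor symmetric in the slots of its side, then NO choice of co-local long
factors makes the system write `D₅`: the configuration is D-INFEASIBLE (`δ = 0`).  No locality of `u`, no bound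
on `N` or on the weight is needed. -/
theorem symShort_sliceFree_not_D_design {N : ℕ} (T : Finset (Fin N)) (S : Fin N → Finset (Fin 5))
    (u w : Fin N → (Fin 5 → Fin 5) → ℂ)
    (hw : ∀ t ∈ T, ∀ v v' : Fin 5 → Fin 5, (∀ i, i ∉ S t → v i = v' i) → w t v = w t v')
    (h2 : ∀ t ∈ T, 2 ≤ (S t).card)
    (hsym : ∀ t ∈ T, SlotInvariantOn (S t) (u t)) :
    ¬ ∀ v : Fin 5 → Fin 5, (∑ t ∈ T, u t v * w t v) = (sgn5 (v 0) (v 1) (v 2) (v 3) (v 4) : ℂ) := by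
  intro hD
  apply sum_sgnW_sq_ne_zero
  calc ∑ v : Fin 5 → Fin 5, (sgnW v : ℂ) * (sgnW v : ℂ)
      = ∑ v : Fin 5 → Fin 5, (sgnW v : ℂ) * ∑ t ∈ T, u t v * w t v := by
        refine Finset.sum_congr rfl fun v _ => by rw [hD v]; rfl
    _ = ∑ t ∈ T, ∑ v : Fin 5 → Fin 5, (sgnW v : ℂ) * (u t v * w t v) := by
        rw [Finset.sum_comm]; refine Finset.sum_congr rfl fun v _ => Finset.mul_sum _ _ _
    _ = ∑ t ∈ T, (0 : ℂ) := by
        refine Finset.sum_congr rfl fun t ht => ?_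
        obtain ⟨i, hi, j, hj, hij⟩ := Finset.one_lt_card.mp (h2 t ht)
        have hfix : ∀ x, x ∉ S t → Equiv.swap i j x = x := fun x hx =>
          Equiv.swap_apply_of_ne_of_ne (fun h => hx (h ▸ hi)) (fun h => hx (h ▸ hj))
        refine term_pairing_sgnW_zero i j hij (u t) (w t) (hsym t ht (Equiv.swap i j) hfix) ?_
        intro v
        exact hw t ht _ _ (fun x hx => by simp [Function.comp_apply, hfix x hx])
    _ = 0 := Finset.sum_const_zero

/-- The same with the roles exchanged: long factors symmetric in the slots of their side (at least two of
them) and local short factors. -/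
theorem symLong_not_D_design {N : ℕ} (T : Finset (Fin N)) (S : Fin N → Finset (Fin 5))
    (u w : Fin N → (Fin 5 → Fin 5) → ℂ)
    (hu : ∀ t ∈ T, ∀ v v' : Fin 5 → Fin 5, (∀ i ∈ S t, v i = v' i) → u t v = u t v')
    (h2 : ∀ t ∈ T, 2 ≤ ((S t)ᶜ).card)
    (hsym : ∀ t ∈ T, SlotInvariantOn (S t)ᶜ (w t)) :
    ¬ ∀ v : Fin 5 → Fin 5, (∑ t ∈ T, u t v * w t v) = (sgn5 (v 0) (v 1) (v 2) (v 3) (v 4) : ℂ) := by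
  intro hD
  apply sum_sgnW_sq_ne_zero
  calc ∑ v : Fin 5 → Fin 5, (sgnW v : ℂ) * (sgnW v : ℂ)
      = ∑ v : Fin 5 → Fin 5, (sgnW v : ℂ) * ∑ t ∈ T, u t v * w t v := by
        refine Finset.sum_congr rfl fun v _ => by rw [hD v]; rfl
    _ = ∑ t ∈ T, ∑ v : Fin 5 → Fin 5, (sgnW v : ℂ) * (u t v * w t v) := by
        rw [Finset.sum_comm]; refine Finset.sum_congr rfl fun v _ => Finset.mul_sum _ _ _
    _ = ∑ t ∈ T, (0 : ℂ) := by
        refine Finset.sum_congr rfl fun t ht => ?_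
        obtain ⟨i, hi, j, hj, hij⟩ := Finset.one_lt_card.mp (h2 t ht)
        have hfix : ∀ x, x ∉ (S t)ᶜ → Equiv.swap i j x = x := fun x hx =>
          Equiv.swap_apply_of_ne_of_ne (fun h => hx (h ▸ hi)) (fun h => hx (h ▸ hj))
        refine term_pairing_sgnW_zero i j hij (u t) (w t) ?_ (hsym t ht (Equiv.swap i j) hfix)
        intro v
        refine hu t ht _ _ (fun x hx => by
          have hx' : x ∉ (S t)ᶜ := by simpa using hx
          simp [Function.comp_apply, hfix x hx'])
    _ = 0 := Finset.sum_const_zero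

/-- **Π2(a′), system level: `D₅` HAS NO SIDE-SYMMETRIC SPLIT DECOMPOSITION** — on any profile (slices
included), any number of terms, any weight.  (Each term has a side with `≥ 2` slots, `5` being `≥ 3`.)  This is
the «sign projector» remark of LINE shallow_collision (S2′/S3′ SIGN CALIBRATION), now a theorem. -/
theorem sideSymmetric_not_D_design {N : ℕ} (T : Finset (Fin N)) (S : Fin N → Finset (Fin 5))
    (u w : Fin N → (Fin 5 → Fin 5) → ℂ)
    (hu : ∀ t ∈ T, ∀ v v' : Fin 5 → Fin 5, (∀ i ∈ S t, v i = v' i) → u t v = u t v')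
    (hw : ∀ t ∈ T, ∀ v v' : Fin 5 → Fin 5, (∀ i, i ∉ S t → v i = v' i) → w t v = w t v')
    (hsym : SideSymmetric T S u w) :
    ¬ ∀ v : Fin 5 → Fin 5, (∑ t ∈ T, u t v * w t v) = (sgn5 (v 0) (v 1) (v 2) (v 3) (v 4) : ℂ) := by
  intro hD
  apply sum_sgnW_sq_ne_zero
  calc ∑ v : Fin 5 → Fin 5, (sgnW v : ℂ) * (sgnW v : ℂ)
      = ∑ v : Fin 5 → Fin 5, (sgnW v : ℂ) * ∑ t ∈ T, u t v * w t v := by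
        refine Finset.sum_congr rfl fun v _ => by rw [hD v]; rfl
    _ = ∑ t ∈ T, ∑ v : Fin 5 → Fin 5, (sgnW v : ℂ) * (u t v * w t v) := by
        rw [Finset.sum_comm]; refine Finset.sum_congr rfl fun v _ => Finset.mul_sum _ _ _
    _ = ∑ t ∈ T, (0 : ℂ) := by
        refine Finset.sum_congr rfl fun t ht => ?_
        by_cases hc : 2 ≤ (S t).card
        · obtain ⟨i, hi, j, hj, hij⟩ := Finset.one_lt_card.mp hc
          have hfix : ∀ x, x ∉ S t → Equiv.swap i j x = x := fun x hx =>
            Equiv.swap_apply_of_ne_of_ne (fun h => hx (h ▸ hi)) (fun h => hx (h ▸ hj))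
          refine term_pairing_sgnW_zero i j hij (u t) (w t) ((hsym t ht).1 (Equiv.swap i j) hfix) ?_
          intro v
          exact hw t ht _ _ (fun x hx => by simp [Function.comp_apply, hfix x hx])
        · have hc' : 2 ≤ ((S t)ᶜ).card := by
            have := Finset.card_compl (S t)
            simp only [Fintype.card_fin] at this
            have h5 : (S t).card ≤ 5 := by simpa using Finset.card_le_univ (S t)
            omega
          obtain ⟨i, hi, j, hj, hij⟩ := Finset.one_lt_card.mp hc'
          have hfix : ∀ x, x ∉ (S t)ᶜ → Equiv.swap i j x = x := fun x hx =>
            Equiv.swap_apply_of_ne_of_ne (fun h => hx (h ▸ hi)) (fun h => hx (h ▸ hj))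
          refine term_pairing_sgnW_zero i j hij (u t) (w t) ?_ ((hsym t ht).2 (Equiv.swap i j) hfix)
          intro v
          refine hu t ht _ _ (fun x hx => by
            have hx' : x ∉ (S t)ᶜ := by simpa using hx
            simp [Function.comp_apply, hfix x hx'])
    _ = 0 := Finset.sum_const_zero


/-- **TIE TO THE LINE (1): `δ = 1` forces the ASYMMETRIC sector.**  If a slice-free configuration `(T, S, u)`
carries an honest design of `D₅` (some co-local `wD`), then NO system on it is side-symmetric — whatever the
long factors `w` (in particular the `P₅`-system of K1's hypothesis): it lies in the sector of S3′ /
`AsymLaplaceOptimalFive`, never in S2′'s. -/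
theorem dFeasible_sliceFree_not_sideSymmetric {N : ℕ} (T : Finset (Fin N)) (S : Fin N → Finset (Fin 5))
    (u w wD : Fin N → (Fin 5 → Fin 5) → ℂ)
    (hwD : ∀ t ∈ T, ∀ v v' : Fin 5 → Fin 5, (∀ i, i ∉ S t → v i = v' i) → wD t v = wD t v')
    (hD : ∀ v : Fin 5 → Fin 5, (∑ t ∈ T, u t v * wD t v) = (sgn5 (v 0) (v 1) (v 2) (v 3) (v 4) : ℂ))
    (h2 : ∀ t ∈ T, 2 ≤ (S t).card) :
    ¬ SideSymmetric T S u w := by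
  intro hs
  exact symShort_sliceFree_not_D_design T S u wD hwD h2 (fun t ht => (hs t ht).1) hD

/-- **TIE TO THE LINE (2): K1 on slice-free profiles is a SUB-SECTOR of the asymmetric sector.**  The tree's
`AsymLaplaceOptimalFive` (young-shadow K2 = the sector of S3′ before weight-minimality) implies
`DFeasibleLaplaceOptimalFive` restricted to slice-free profiles.  (Honest reading: the pencil's instrument —
generic member / functionals on `L(U)` — is a tool on part of the RESIDUAL sector, where the line has none; it
says nothing on S2′'s symmetric sector, which is entirely `δ = 0`.) -/
theorem dFeasibleSliceFree_of_asymSector (hA : AsymLaplaceOptimalFive) :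
    ∀ (N : ℕ) (T : Finset (Fin N)) (S : Fin N → Finset (Fin 5))
      (u wD wP : Fin N → (Fin 5 → Fin 5) → ℂ),
      (∀ t, ∀ v v' : Fin 5 → Fin 5, (∀ i ∈ S t, v i = v' i) → u t v = u t v') →
      (∀ t, ∀ v v' : Fin 5 → Fin 5, (∀ i, i ∉ S t → v i = v' i) → wD t v = wD t v') →
      (∀ t, ∀ v v' : Fin 5 → Fin 5, (∀ i, i ∉ S t → v i = v' i) → wP t v = wP t v') →
      (∀ v : Fin 5 → Fin 5, (∑ t ∈ T, u t v * wD t v) = (sgn5 (v 0) (v 1) (v 2) (v 3) (v 4) : ℂ)) →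
      (∀ v : Fin 5 → Fin 5, (∑ t ∈ T, u t v * wP t v) = if Function.Injective v then 1 else 0) →
      (∀ t ∈ T, 2 ≤ (S t).card) →
      Nat.factorial 5 ≤ ∑ t ∈ T, (S t).card.factorial * (5 - (S t).card).factorial := by
  intro N T S u wD wP hu hwD hwP hD hP h2
  exact hA N T S u wP ⟨hu, hwP, hP⟩
    (dFeasible_sliceFree_not_sideSymmetric T S u wP wD (fun t _ => hwD t) hD h2)

/-- **HONEST PAIR-LAPLACE IS `δ = 0`.**  Special case worth naming: a configuration all of whose short factors
are `2 × 2` PERMANENT patterns `[{v i, v j} = {a, b}]` (slot-symmetric by construction) on pair splits — e.g.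
the honest weight-120 pair-Laplace expansion of `P₅` — carries no design of `D₅`.  Stated for an arbitrary
family of slot-symmetric pair factors. -/
theorem pairConfiguration_symmetric_D_infeasible {N : ℕ} (T : Finset (Fin N)) (S : Fin N → Finset (Fin 5))
    (u w : Fin N → (Fin 5 → Fin 5) → ℂ)
    (hpair : ∀ t ∈ T, (S t).card = 2)
    (hsym : ∀ t ∈ T, SlotInvariantOn (S t) (u t))
    (hw : ∀ t ∈ T, ∀ v v' : Fin 5 → Fin 5, (∀ i, i ∉ S t → v i = v' i) → w t v = w t v') :
    ¬ ∀ v : Fin 5 → Fin 5, (∑ t ∈ T, u t v * w t v) = (sgn5 (v 0) (v 1) (v 2) (v 3) (v 4) : ℂ) :=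
  symShort_sliceFree_not_D_design T S u w hw (fun t ht => by rw [hpair t ht]) hsym

end PiTwo


/-! ## §6 The PENCIL LEMMA in kernel and K2 typed TODAY (crit-3 g6 sharpening: HGEN needs no closure)

For a profile predicate `Pr` on `(N, T, S)`:  `DesignOn Pr X` — the pattern `X` has an honest design on a
`Pr`-profile;  `HGen Pr` — SOME member `T_s = A⁺ + s·A⁻` of the sign pencil has none;  `DFeasibleLO5On Pr` — K1
restricted to `Pr`-profiles.  PENCIL LEMMA (`dFeasibleOn_of_hGen`): `HGen Pr → DFeasibleLO5On Pr`, because a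
D-design and a P-design on the same short factors combine to a design of EVERY `T_s`
(`T_s = ((1+s)/2)·P₅ + ((1−s)/2)·D₅`).  Zariski closure enters only as a METHOD for proving `HGen`
(closed invariants evaluated at a generic `s`).  The two LM tail profiles are typed as `StarTail`
(`3·01 + 2·02 + 2·03 + 2·04`, hub slot `0`, sub-profiles included) and `SixTail`
(`2·01 + 02 + 03 + 04 + 12 + 13 + 14`); K2 of the card = `HGenStar` / `HGenSix`. -/

section PencilLemma

/-- The profile-relative notion «`X` has an honest design on a `Pr`-profile» (LO5's data format). -/
def DesignOn (Pr : (N : ℕ) → Finset (Fin N) → (Fin N → Finset (Fin 5)) → Prop)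
    (X : (Fin 5 → Fin 5) → ℂ) : Prop :=
  ∃ (N : ℕ) (T : Finset (Fin N)) (S : Fin N → Finset (Fin 5)) (u w : Fin N → (Fin 5 → Fin 5) → ℂ),
    Pr N T S ∧
    (∀ t, ∀ v v' : Fin 5 → Fin 5, (∀ i ∈ S t, v i = v' i) → u t v = u t v') ∧
    (∀ t, ∀ v v' : Fin 5 → Fin 5, (∀ i, i ∉ S t → v i = v' i) → w t v = w t v') ∧
    (∀ v : Fin 5 → Fin 5, (∑ t ∈ T, u t v * w t v) = X v)

/-- The pencil member `T_s = A⁺ + s·A⁻` as a complex table on words (`T₁ = P₅`, `T₋₁ = D₅`, `T₀ = A⁺`). -/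
def pencilT (s : ℂ) (v : Fin 5 → Fin 5) : ℂ :=
  (aPlus (v 0) (v 1) (v 2) (v 3) (v 4) : ℂ) + s * (aMinus (v 0) (v 1) (v 2) (v 3) (v 4) : ℂ)

/-- **HGEN(Pr)**: some member of the sign pencil has NO honest `Pr`-design. -/
def HGen (Pr : (N : ℕ) → Finset (Fin N) → (Fin N → Finset (Fin 5)) → Prop) : Prop :=
  ∃ s : ℂ, ¬ DesignOn Pr (pencilT s)

/-- **K1 restricted to `Pr`-profiles.** -/
def DFeasibleLO5On (Pr : (N : ℕ) → Finset (Fin N) → (Fin N → Finset (Fin 5)) → Prop) : Prop :=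
  ∀ (N : ℕ) (T : Finset (Fin N)) (S : Fin N → Finset (Fin 5))
    (u wD wP : Fin N → (Fin 5 → Fin 5) → ℂ), Pr N T S →
    (∀ t, ∀ v v' : Fin 5 → Fin 5, (∀ i ∈ S t, v i = v' i) → u t v = u t v') →
    (∀ t, ∀ v v' : Fin 5 → Fin 5, (∀ i, i ∉ S t → v i = v' i) → wD t v = wD t v') →
    (∀ t, ∀ v v' : Fin 5 → Fin 5, (∀ i, i ∉ S t → v i = v' i) → wP t v = wP t v') →
    (∀ v : Fin 5 → Fin 5, (∑ t ∈ T, u t v * wD t v) = (sgn5 (v 0) (v 1) (v 2) (v 3) (v 4) : ℂ)) →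
    (∀ v : Fin 5 → Fin 5, (∑ t ∈ T, u t v * wP t v) = if Function.Injective v then 1 else 0) →
    Nat.factorial 5 ≤ ∑ t ∈ T, (S t).card.factorial * (5 - (S t).card).factorial

/-- K1 restricted to all profiles is K1. -/
theorem dFeasibleLO5On_univ_iff : DFeasibleLO5On (fun _ _ _ => True) ↔ DFeasibleLaplaceOptimalFive := by
  constructor
  · intro h N T S u wD wP hu hwD hwP hD hP; exact h N T S u wD wP trivial hu hwD hwP hD hP
  · intro h N T S u wD wP _ hu hwD hwP hD hP; exact h N T S u wD wP hu hwD hwP hD hP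

/-- A D-design and a P-design on the same short factors give a design of EVERY pencil member. -/
theorem pencil_member_design {N : ℕ} (T : Finset (Fin N)) (u wD wP : Fin N → (Fin 5 → Fin 5) → ℂ) (s : ℂ)
    (hD : ∀ v : Fin 5 → Fin 5, (∑ t ∈ T, u t v * wD t v) = (sgn5 (v 0) (v 1) (v 2) (v 3) (v 4) : ℂ))
    (hP : ∀ v : Fin 5 → Fin 5, (∑ t ∈ T, u t v * wP t v) = if Function.Injective v then 1 else 0) :
    ∀ v : Fin 5 → Fin 5,
      (∑ t ∈ T, u t v * (((1 + s) / 2) * wP t v + ((1 - s) / 2) * wD t v)) = pencilT s v := by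
  intro v
  have h1 := hD v
  have h2 := hP v
  rw [← pat5_indicator v] at h2
  have h3 := pat5_eq_aPlus_add_aMinus (v 0) (v 1) (v 2) (v 3) (v 4)
  have h4 := sgn5_eq_aPlus_sub_aMinus (v 0) (v 1) (v 2) (v 3) (v 4)
  have h5 : (∑ t ∈ T, u t v * (((1 + s) / 2) * wP t v + ((1 - s) / 2) * wD t v))
      = ((1 + s) / 2) * (∑ t ∈ T, u t v * wP t v) + ((1 - s) / 2) * ∑ t ∈ T, u t v * wD t v := by
    rw [Finset.mul_sum, Finset.mul_sum, ← Finset.sum_add_distrib]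
    refine Finset.sum_congr rfl ?_; intro t _; ring
  rw [h5, h1, h2, pencilT, h3, h4]; push_cast; ring

/-- **PENCIL LEMMA (R3 of the card, kernel): `HGen Pr → DFeasibleLO5On Pr`** — on a profile where one pencil
member is honestly infeasible, no configuration carries both `D₅` and `P₅`, so K1 holds there (vacuously in
its hypotheses: every D-feasible `Pr`-configuration misses `P₅`). -/
theorem dFeasibleOn_of_hGen (Pr : (N : ℕ) → Finset (Fin N) → (Fin N → Finset (Fin 5)) → Prop)
    (h : HGen Pr) : DFeasibleLO5On Pr := by
  obtain ⟨s, hs⟩ := h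
  intro N T S u wD wP hPr hu hwD hwP hD hP
  exfalso
  apply hs
  refine ⟨N, T, S, u, fun t v => ((1 + s) / 2) * wP t v + ((1 - s) / 2) * wD t v, hPr, hu, ?_, ?_⟩
  · intro t v v' hvv'
    show ((1 + s) / 2) * wP t v + ((1 - s) / 2) * wD t v = ((1 + s) / 2) * wP t v' + ((1 - s) / 2) * wD t v'
    rw [hwP t v v' hvv', hwD t v v' hvv']
  · exact pencil_member_design T u wD wP s hD hP

/-- The LM tail profile STAR `3·01 + 2·02 + 2·03 + 2·04` (hub slot `0`; sub-profiles included). -/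
def StarTail (N : ℕ) (T : Finset (Fin N)) (S : Fin N → Finset (Fin 5)) : Prop :=
  (∀ t ∈ T, S t = {0, 1} ∨ S t = {0, 2} ∨ S t = {0, 3} ∨ S t = {0, 4}) ∧
  (T.filter (fun t => S t = {0, 1})).card ≤ 3 ∧ (T.filter (fun t => S t = {0, 2})).card ≤ 2 ∧
  (T.filter (fun t => S t = {0, 3})).card ≤ 2 ∧ (T.filter (fun t => S t = {0, 4})).card ≤ 2

/-- The LM tail profile `2·01 + 02 + 03 + 04 + 12 + 13 + 14` (sub-profiles included). -/
def SixTail (N : ℕ) (T : Finset (Fin N)) (S : Fin N → Finset (Fin 5)) : Prop :=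
  (∀ t ∈ T, S t = {0, 1} ∨ S t = {0, 2} ∨ S t = {0, 3} ∨ S t = {0, 4} ∨ S t = {1, 2} ∨ S t = {1, 3} ∨
    S t = {1, 4}) ∧
  (T.filter (fun t => S t = {0, 1})).card ≤ 2 ∧ (T.filter (fun t => S t = {0, 2})).card ≤ 1 ∧
  (T.filter (fun t => S t = {0, 3})).card ≤ 1 ∧ (T.filter (fun t => S t = {0, 4})).card ≤ 1 ∧
  (T.filter (fun t => S t = {1, 2})).card ≤ 1 ∧ (T.filter (fun t => S t = {1, 3})).card ≤ 1 ∧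
  (T.filter (fun t => S t = {1, 4})).card ≤ 1

/-- **K2 (card, rank 3): HGEN on the star tail profile.**  Why it might fail: every `T_s` might be honestly
feasible at weight ≤ 108 on the star (then K1 is non-vacuous there and needs the Φ-certificate route); the
`s ↦ 1/s` symmetry (letter transposition) makes `s = 0` (`A⁺` alone) the first member to test (F1). -/
def HGenStar : Prop := HGen StarTail

/-- **K2′ (card, rank 3): HGEN on the `2·01 + six` tail profile.** -/
def HGenSix : Prop := HGen SixTail

/-- K2 ⟹ K1 on the star tail profile (pencil lemma, by name). -/
theorem dFeasibleLO5On_star_of_hGen (h : HGenStar) : DFeasibleLO5On StarTail := dFeasibleOn_of_hGen _ h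

/-- K2′ ⟹ K1 on the `2·01 + six` tail profile. -/
theorem dFeasibleLO5On_six_of_hGen (h : HGenSix) : DFeasibleLO5On SixTail := dFeasibleOn_of_hGen _ h

/-- Both tail profiles are SLICE-FREE pair profiles, so §5 applies: on them `δ = 1` forces the asymmetric
sector (`dFeasible_sliceFree_not_sideSymmetric`).  The card-count facts, by name. -/
theorem starTail_sliceFree {N : ℕ} (T : Finset (Fin N)) (S : Fin N → Finset (Fin 5)) (h : StarTail N T S) :
    ∀ t ∈ T, 2 ≤ (S t).card := by
  intro t ht
  rcases h.1 t ht with h1 | h1 | h1 | h1 <;> rw [h1] <;> decide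

theorem sixTail_sliceFree {N : ℕ} (T : Finset (Fin N)) (S : Fin N → Finset (Fin 5)) (h : SixTail N T S) :
    ∀ t ∈ T, 2 ≤ (S t).card := by
  intro t ht
  rcases h.1 t ht with h1 | h1 | h1 | h1 | h1 | h1 | h1 <;> rw [h1] <;> decide

/-- Every term of a `StarTail` system is a pair split (weight `12`). -/
theorem starTail_card_two {N : ℕ} (T : Finset (Fin N)) (S : Fin N → Finset (Fin 5)) (h : StarTail N T S) :
    ∀ t ∈ T, (S t).card = 2 := by
  intro t ht
  rcases h.1 t ht with e | e | e | e <;> rw [e] <;> decide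

/-- A `StarTail` system has at most `9` terms, hence weight `≤ 108 < 120`. -/
theorem starTail_weight_le {N : ℕ} (T : Finset (Fin N)) (S : Fin N → Finset (Fin 5)) (h : StarTail N T S) :
    ∑ t ∈ T, (S t).card.factorial * (5 - (S t).card).factorial ≤ 108 := by
  obtain ⟨hS, h1, h2, h3, h4⟩ := h
  have hsum : ∑ t ∈ T, (S t).card.factorial * (5 - (S t).card).factorial = ∑ t ∈ T, 12 :=
    Finset.sum_congr rfl (fun t ht => by rw [starTail_card_two T S ⟨hS, h1, h2, h3, h4⟩ t ht]; decide)
  rw [hsum, Finset.sum_const, smul_eq_mul]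
  have hsub : T ⊆ ((T.filter (fun t => S t = {0, 1}) ∪ T.filter (fun t => S t = {0, 2})) ∪
      T.filter (fun t => S t = {0, 3})) ∪ T.filter (fun t => S t = {0, 4}) := by
    intro t ht
    rcases hS t ht with e | e | e | e
    · exact Finset.mem_union_left _ (Finset.mem_union_left _ (Finset.mem_union_left _ (Finset.mem_filter.mpr ⟨ht, e⟩)))
    · exact Finset.mem_union_left _ (Finset.mem_union_left _ (Finset.mem_union_right _ (Finset.mem_filter.mpr ⟨ht, e⟩)))
    · exact Finset.mem_union_left _ (Finset.mem_union_right _ (Finset.mem_filter.mpr ⟨ht, e⟩))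
    · exact Finset.mem_union_right _ (Finset.mem_filter.mpr ⟨ht, e⟩)
  have c0 := Finset.card_le_card hsub
  have c1 := Finset.card_union_le (((T.filter (fun t => S t = {0, 1}) ∪ T.filter (fun t => S t = {0, 2})) ∪
      T.filter (fun t => S t = {0, 3}))) (T.filter (fun t => S t = {0, 4}))
  have c2 := Finset.card_union_le ((T.filter (fun t => S t = {0, 1}) ∪ T.filter (fun t => S t = {0, 2})))
      (T.filter (fun t => S t = {0, 3}))
  have c3 := Finset.card_union_le (T.filter (fun t => S t = {0, 1})) (T.filter (fun t => S t = {0, 2}))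
  omega

/-- Every term of a `SixTail` system is a pair split. -/
theorem sixTail_card_two {N : ℕ} (T : Finset (Fin N)) (S : Fin N → Finset (Fin 5)) (h : SixTail N T S) :
    ∀ t ∈ T, (S t).card = 2 := by
  intro t ht
  rcases h.1 t ht with e | e | e | e | e | e | e <;> rw [e] <;> decide

/-- A `SixTail` system has at most `8` terms, hence weight `≤ 96 < 120`. -/
theorem sixTail_weight_le {N : ℕ} (T : Finset (Fin N)) (S : Fin N → Finset (Fin 5)) (h : SixTail N T S) :
    ∑ t ∈ T, (S t).card.factorial * (5 - (S t).card).factorial ≤ 96 := by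
  obtain ⟨hS, h1, h2, h3, h4, h5, h6, h7⟩ := h
  have hsum : ∑ t ∈ T, (S t).card.factorial * (5 - (S t).card).factorial = ∑ t ∈ T, 12 :=
    Finset.sum_congr rfl (fun t ht => by
      rw [sixTail_card_two T S ⟨hS, h1, h2, h3, h4, h5, h6, h7⟩ t ht]; decide)
  rw [hsum, Finset.sum_const, smul_eq_mul]
  set F1 := T.filter (fun t => S t = {0, 1})
  set F2 := T.filter (fun t => S t = {0, 2})
  set F3 := T.filter (fun t => S t = {0, 3})
  set F4 := T.filter (fun t => S t = {0, 4})
  set F5 := T.filter (fun t => S t = {1, 2})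
  set F6 := T.filter (fun t => S t = {1, 3})
  set F7 := T.filter (fun t => S t = {1, 4})
  have hsub : T ⊆ (((((F1 ∪ F2) ∪ F3) ∪ F4) ∪ F5) ∪ F6) ∪ F7 := by
    intro t ht
    simp only [Finset.mem_union]
    rcases hS t ht with e | e | e | e | e | e | e
    · exact Or.inl (Or.inl (Or.inl (Or.inl (Or.inl (Or.inl (Finset.mem_filter.mpr ⟨ht, e⟩))))))
    · exact Or.inl (Or.inl (Or.inl (Or.inl (Or.inl (Or.inr (Finset.mem_filter.mpr ⟨ht, e⟩))))))
    · exact Or.inl (Or.inl (Or.inl (Or.inl (Or.inr (Finset.mem_filter.mpr ⟨ht, e⟩)))))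
    · exact Or.inl (Or.inl (Or.inl (Or.inr (Finset.mem_filter.mpr ⟨ht, e⟩))))
    · exact Or.inl (Or.inl (Or.inr (Finset.mem_filter.mpr ⟨ht, e⟩)))
    · exact Or.inl (Or.inr (Finset.mem_filter.mpr ⟨ht, e⟩))
    · exact Or.inr (Finset.mem_filter.mpr ⟨ht, e⟩)
  have c0 := Finset.card_le_card hsub
  have c1 := Finset.card_union_le ((((((F1 ∪ F2) ∪ F3) ∪ F4) ∪ F5) ∪ F6)) F7
  have c2 := Finset.card_union_le (((((F1 ∪ F2) ∪ F3) ∪ F4) ∪ F5)) F6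
  have c3 := Finset.card_union_le ((((F1 ∪ F2) ∪ F3) ∪ F4)) F5
  have c4 := Finset.card_union_le (((F1 ∪ F2) ∪ F3)) F4
  have c5 := Finset.card_union_le ((F1 ∪ F2)) F3
  have c6 := Finset.card_union_le F1 F2
  omega

/-- The pencil member at `s = 1` is `P₅` (the injectivity indicator). -/
theorem pencilT_one (v : Fin 5 → Fin 5) : pencilT 1 v = if Function.Injective v then 1 else 0 := by
  rw [← pat5_indicator v, pencilT, pat5_eq_aPlus_add_aMinus]; push_cast; ring

/-- **HONESTY OF K2: `HGen` on a cheap profile is a CONSEQUENCE of the crux** (instance `s₀ = 1`: under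
`LaplaceOptimalFive`, `P₅ = T₁` has no honest design of weight `< 120`).  So `LO5|π ⟹ HGen π ⟹ K1|π`: K2 is a
sector-type statement, not a strengthening; its CONTENT is an instance `s₀ ≠ ±1`, where closed tools are legal. -/
theorem hGen_of_laplaceOptimalFive_of_cheap
    (Pr : (N : ℕ) → Finset (Fin N) → (Fin N → Finset (Fin 5)) → Prop)
    (hcheap : ∀ (N : ℕ) (T : Finset (Fin N)) (S : Fin N → Finset (Fin 5)), Pr N T S →
      ∑ t ∈ T, (S t).card.factorial * (5 - (S t).card).factorial < Nat.factorial 5)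
    (h : Summit.ValiantsHypothesis.ValiantsHypothesis.Theses.RigidityForcesSymmetry.LaplaceOptimalFive) :
    HGen Pr := by
  refine ⟨1, ?_⟩
  rintro ⟨N, T, S, u, w, hPr, hu, hw, hX⟩
  have hP : ∀ v : Fin 5 → Fin 5, (∑ t ∈ T, u t v * w t v) = if Function.Injective v then 1 else 0 := by
    intro v; rw [hX v, pencilT_one]
  have h120 := h N T S u w hu hw hP
  have := hcheap N T S hPr
  omega

theorem hGenStar_of_laplaceOptimalFive
    (h : Summit.ValiantsHypothesis.ValiantsHypothesis.Theses.RigidityForcesSymmetry.LaplaceOptimalFive) :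
    HGenStar :=
  hGen_of_laplaceOptimalFive_of_cheap StarTail
    (fun N T S hS => by have := starTail_weight_le T S hS; simp only [Nat.factorial]; omega) h

theorem hGenSix_of_laplaceOptimalFive
    (h : Summit.ValiantsHypothesis.ValiantsHypothesis.Theses.RigidityForcesSymmetry.LaplaceOptimalFive) :
    HGenSix :=
  hGen_of_laplaceOptimalFive_of_cheap SixTail
    (fun N T S hS => by have := sixTail_weight_le T S hS; simp only [Nat.factorial]; omega) h

/-! ### §6b Navigating the pencil for F1 (crit-3 symmetry note, kernel): `s ↦ 1/s` and `0 ↔ ∞`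
The letter transposition `sw = (0 1)` exchanges `A⁺` and `A⁻`, so `T_s ∘ sw = s · T_{1/s}`; on any profile
predicate (profiles are slot data, untouched by letter relabelling) honest feasibility of `T_s` and of
`T_{1/s}` are equivalent, and that of `A⁺ = T_0` and `A⁻` («`T_∞`») are.  Hence F1 tests `s = 0` first and
then `s` only up to `s ↦ 1/s`. -/

theorem sw_sw (x : Fin 5) : sw (sw x) = x := by revert x; decide

theorem aMinus_eq_aPlus_sw :
    ∀ a b c d e : Fin 5, aMinus a b c d e = aPlus (sw a) (sw b) (sw c) (sw d) (sw e) := by decide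

theorem pencilT_zero (v : Fin 5 → Fin 5) : pencilT 0 v = (aPlus (v 0) (v 1) (v 2) (v 3) (v 4) : ℂ) := by
  simp [pencilT]

theorem pencilT_neg_one (v : Fin 5 → Fin 5) :
    pencilT (-1) v = (sgn5 (v 0) (v 1) (v 2) (v 3) (v 4) : ℂ) := by
  rw [pencilT, sgn5_eq_aPlus_sub_aMinus]; push_cast; ring

/-- `T_s ∘ sw = A⁻ + s·A⁺`. -/
theorem pencilT_sw (s : ℂ) (v : Fin 5 → Fin 5) :
    pencilT s (sw ∘ v) = (aMinus (v 0) (v 1) (v 2) (v 3) (v 4) : ℂ) + s * (aPlus (v 0) (v 1) (v 2) (v 3) (v 4) : ℂ) := by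
  simp only [pencilT, Function.comp_apply]
  rw [← aMinus_eq_aPlus_sw, ← aPlus_eq_aMinus_sw]

/-- Letter relabelling by `sw` transports honest designs on any profile predicate. -/
theorem designOn_sw (Pr : (N : ℕ) → Finset (Fin N) → (Fin N → Finset (Fin 5)) → Prop)
    (X : (Fin 5 → Fin 5) → ℂ) (h : DesignOn Pr X) : DesignOn Pr (fun v => X (sw ∘ v)) := by
  obtain ⟨N, T, S, u, w, hPr, hu, hw, hX⟩ := h
  refine ⟨N, T, S, fun t v => u t (sw ∘ v), fun t v => w t (sw ∘ v), hPr,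
    relabel_local S u sw hu, relabel_colocal S w sw hw, fun v => ?_⟩
  exact hX (sw ∘ v)

/-- Rescaling transports honest designs. -/
theorem designOn_smul (Pr : (N : ℕ) → Finset (Fin N) → (Fin N → Finset (Fin 5)) → Prop)
    (X : (Fin 5 → Fin 5) → ℂ) (c : ℂ) (h : DesignOn Pr X) : DesignOn Pr (fun v => c * X v) := by
  obtain ⟨N, T, S, u, w, hPr, hu, hw, hX⟩ := h
  refine ⟨N, T, S, fun t v => c * u t v, w, hPr, scale_local S u c hu, hw, fun v => ?_⟩
  have : (∑ t ∈ T, c * u t v * w t v) = c * ∑ t ∈ T, u t v * w t v := by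
    rw [Finset.mul_sum]; exact Finset.sum_congr rfl (fun t _ => by ring)
  rw [this, hX v]

/-- **`A⁺` is honestly `Pr`-feasible iff `A⁻` is** (`s = 0 ↔ s = ∞`). -/
theorem designOn_aPlus_iff_aMinus (Pr : (N : ℕ) → Finset (Fin N) → (Fin N → Finset (Fin 5)) → Prop) :
    DesignOn Pr (fun v => (aPlus (v 0) (v 1) (v 2) (v 3) (v 4) : ℂ)) ↔
      DesignOn Pr (fun v => (aMinus (v 0) (v 1) (v 2) (v 3) (v 4) : ℂ)) := by
  constructor
  · intro h
    have h' := designOn_sw Pr _ h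
    refine cast (congrArg (DesignOn Pr) (funext fun v => ?_)) h'
    simp only [Function.comp_apply]
    rw [aMinus_eq_aPlus_sw]
  · intro h
    have h' := designOn_sw Pr _ h
    refine cast (congrArg (DesignOn Pr) (funext fun v => ?_)) h'
    simp only [Function.comp_apply]
    rw [aPlus_eq_aMinus_sw]

/-- **`T_s` is honestly `Pr`-feasible iff `T_{1/s}` is** (`s ≠ 0`). -/
theorem designOn_pencilT_inv (Pr : (N : ℕ) → Finset (Fin N) → (Fin N → Finset (Fin 5)) → Prop)
    (s : ℂ) (hs : s ≠ 0) (h : DesignOn Pr (pencilT s)) : DesignOn Pr (pencilT s⁻¹) := by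
  have h1 := designOn_smul Pr _ s⁻¹ (designOn_sw Pr _ h)
  refine cast (congrArg (DesignOn Pr) (funext fun v => ?_)) h1
  show s⁻¹ * pencilT s (sw ∘ v) = pencilT s⁻¹ v
  rw [pencilT_sw, pencilT]
  field_simp
  ring

theorem designOn_pencilT_inv_iff (Pr : (N : ℕ) → Finset (Fin N) → (Fin N → Finset (Fin 5)) → Prop)
    (s : ℂ) (hs : s ≠ 0) : DesignOn Pr (pencilT s) ↔ DesignOn Pr (pencilT s⁻¹) := by
  refine ⟨designOn_pencilT_inv Pr s hs, fun h => ?_⟩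
  have := designOn_pencilT_inv Pr s⁻¹ (inv_ne_zero hs) h
  rwa [inv_inv] at this

end PencilLemma


/-! ### §6c `δ = 1` OCCURS HONESTLY ON BOTH TAIL PROFILES — EXACTLY (typed; answers g9's Q1 without kit)
`DesignOn StarTail (T_{-1})` at weight 96 (`hub2222_design`) and `DesignOn SixTail (T_{-1})` at weight 84
(`twohub84_design`).  Consequences for the card: K1 is NON-VACUOUS on `StarTail` AND on `SixTail`; for
K2 = `HGenStar` / K2′ = `HGenSix` the instances `s₀ = ±1` are gone (`s₀ = 1` is the crux, `s₀ = −1` is refuted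
here), so the content of K2/K2′ is an `s₀ ∉ {±1}` — by §6b, F1 at `s = 0` first, then `s` modulo `s ↦ 1/s`.
By §5 T2 the short factors of any such design cannot all be slot-symmetric; indeed `ω` is antisymmetric and
`θ⊗e⁰` asymmetric. -/

section ExactTailDesigns

/-- splits of the `2222` star system. -/
def S8i (t : Fin 8) : Finset (Fin 5) :=
  if t = 0 ∨ t = 1 then {0, 1} else if t = 2 ∨ t = 3 then {0, 2} else if t = 4 ∨ t = 5 then {0, 3} else {0, 4}

/-- its short factors (signs folded in) … -/
def u8 (t : Fin 8) (v : Fin 5 → Fin 5) : ℤ :=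
  if t = 0 then om (v 0) (v 1) else if t = 1 then th (v 0) * e0 (v 1)
  else if t = 2 then -(om (v 0) (v 2)) else if t = 3 then -(th (v 0) * e0 (v 2))
  else if t = 4 then om (v 0) (v 3) else if t = 5 then th (v 0) * e0 (v 3)
  else if t = 6 then -(om (v 0) (v 4)) else -(th (v 0) * e0 (v 4))

/-- … and long factors. -/
def w8 (t : Fin 8) (v : Fin 5 → Fin 5) : ℤ :=
  if t = 0 then thom (v 2) (v 3) (v 4) else if t = 1 then E123 (v 2) (v 3) (v 4)
  else if t = 2 then thom (v 1) (v 3) (v 4) else if t = 3 then E123 (v 1) (v 3) (v 4)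
  else if t = 4 then thom (v 1) (v 2) (v 4) else if t = 5 then E123 (v 1) (v 2) (v 4)
  else if t = 6 then thom (v 1) (v 2) (v 3) else E123 (v 1) (v 2) (v 3)

theorem starTail_S8i : StarTail 8 Finset.univ S8i := by
  unfold StarTail S8i; decide

theorem u8_local : ∀ t, ∀ v v' : Fin 5 → Fin 5, (∀ i ∈ S8i t, v i = v' i) → (u8 t v : ℂ) = u8 t v' := by
  intro t v v' h
  fin_cases t <;> simp [S8i] at h <;> simp [u8, h]

theorem w8_colocal :
    ∀ t, ∀ v v' : Fin 5 → Fin 5, (∀ i, i ∉ S8i t → v i = v' i) → (w8 t v : ℂ) = w8 t v' := by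
  intro t v v' h
  fin_cases t <;> simp [S8i] at h <;> simp [w8, h]

theorem sum8_eq (v : Fin 5 → Fin 5) :
    (∑ t ∈ (Finset.univ : Finset (Fin 8)), (u8 t v : ℂ) * (w8 t v : ℂ)) = pencilT (-1) v := by
  have hz := hub2222_design (v 0) (v 1) (v 2) (v 3) (v 4)
  have hc := congrArg (Int.cast : ℤ → ℂ) hz
  push_cast at hc
  rw [pencilT_neg_one, Fin.sum_univ_eight]
  simp [u8, w8]
  linear_combination hc

/-- **`δ = 1` occurs honestly on `StarTail`, exactly, at weight 96** (so K1|StarTail is non-vacuous and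
`s₀ = −1` is not an instance for `HGenStar`). -/
theorem designOn_starTail_D5 : DesignOn StarTail (pencilT (-1)) :=
  ⟨8, Finset.univ, S8i, fun t v => (u8 t v : ℂ), fun t v => (w8 t v : ℂ), starTail_S8i, u8_local,
    w8_colocal, sum8_eq⟩

/-- splits of the `84` two-hub system. -/
def S7i (t : Fin 7) : Finset (Fin 5) :=
  if t = 0 then {0, 1} else if t = 1 then {0, 2} else if t = 2 then {0, 3} else if t = 3 then {0, 4}
  else if t = 4 then {1, 2} else if t = 5 then {1, 3} else {1, 4}

def u7 (t : Fin 7) (v : Fin 5 → Fin 5) : ℤ :=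
  if t = 0 then om (v 0) (v 1) else if t = 1 then -(om (v 0) (v 2)) else if t = 2 then om (v 0) (v 3)
  else if t = 3 then -(om (v 0) (v 4)) else if t = 4 then om (v 1) (v 2) else if t = 5 then -(om (v 1) (v 3))
  else om (v 1) (v 4)

def w7 (t : Fin 7) (v : Fin 5 → Fin 5) : ℤ :=
  if t = 0 then thom (v 2) (v 3) (v 4) else if t = 1 then thom (v 1) (v 3) (v 4)
  else if t = 2 then thom (v 1) (v 2) (v 4) else if t = 3 then thom (v 1) (v 2) (v 3)
  else if t = 4 then th (v 0) * om (v 3) (v 4) else if t = 5 then th (v 0) * om (v 2) (v 4)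
  else th (v 0) * om (v 2) (v 3)

theorem sixTail_S7i : SixTail 7 Finset.univ S7i := by
  unfold SixTail S7i; decide

theorem u7_local : ∀ t, ∀ v v' : Fin 5 → Fin 5, (∀ i ∈ S7i t, v i = v' i) → (u7 t v : ℂ) = u7 t v' := by
  intro t v v' h
  fin_cases t <;> simp [S7i] at h <;> simp [u7, h]

theorem w7_colocal :
    ∀ t, ∀ v v' : Fin 5 → Fin 5, (∀ i, i ∉ S7i t → v i = v' i) → (w7 t v : ℂ) = w7 t v' := by
  intro t v v' h
  fin_cases t <;> simp [S7i] at h <;> simp [w7, h]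

theorem sum7_eq (v : Fin 5 → Fin 5) :
    (∑ t ∈ (Finset.univ : Finset (Fin 7)), (u7 t v : ℂ) * (w7 t v : ℂ)) = pencilT (-1) v := by
  have hz := twohub84_design (v 0) (v 1) (v 2) (v 3) (v 4)
  have hc := congrArg (Int.cast : ℤ → ℂ) hz
  push_cast at hc
  rw [pencilT_neg_one, Fin.sum_univ_seven]
  simp [u7, w7]
  linear_combination hc

/-- **`δ = 1` occurs honestly on `SixTail`, exactly, at weight 84** (K1|SixTail non-vacuous; `s₀ = −1` is not
an instance for `HGenSix`; g9's Q1 to val-lit-p4 answered YES without kit). -/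
theorem designOn_sixTail_D5 : DesignOn SixTail (pencilT (-1)) :=
  ⟨7, Finset.univ, S7i, fun t v => (u7 t v : ℂ), fun t v => (w7 t v : ℂ), sixTail_S7i, u7_local,
    w7_colocal, sum7_eq⟩

/-- Hence on both tails `HGen` cannot be witnessed at `s = −1` (nor at `s = 1` if the crux holds): -/
theorem hGenStar_witness_ne_neg_one (s : ℂ) (h : ¬ DesignOn StarTail (pencilT s)) : s ≠ -1 := by
  rintro rfl; exact h designOn_starTail_D5

theorem hGenSix_witness_ne_neg_one (s : ℂ) (h : ¬ DesignOn SixTail (pencilT s)) : s ≠ -1 := by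
  rintro rfl; exact h designOn_sixTail_D5

end ExactTailDesigns

/-! ## §7 The TWO-WORD PENCIL LEMMA (general, in `LaplaceOptimal`'s data format)
The mechanism of §2b/§2c/§2d made general.  A configuration `U = (S, u)`, two words `w` (even), `w'` (odd)
and a scalar `c` such that every term either sees the same long word at `w, w'` with short values in ratio
`u_t(w) = −c·u_t(w')`, or has short factor vanishing at both: then every pencil member `T_s` honestly carried
by `U` (ANY co-local long factors) has `1 + c·s = 0`.  ANTISYMMETRIC distinguishing factor (`c = 1`): `U`
carries only `D₅` among the pencil (hub, `2222`, `84`); SYMMETRIC (`c = −1`): only `P₅` (the p629937 star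
border configuration, §2c).  A configuration violating K1 (carrying `D₅` AND `P₅`) therefore isolates NO
transposition pair of words in this way — a combinatorial necessary condition (vacuous for short factors
without zeros: this is an instance tool, not a proof of K1). -/

theorem pencilT_of_sgn_pos (s : ℂ) (w : Fin 5 → Fin 5) (h : sgn5 (w 0) (w 1) (w 2) (w 3) (w 4) = 1) :
    pencilT s w = 1 := by
  simp [pencilT, aPlus, aMinus, h]

theorem pencilT_of_sgn_neg (s : ℂ) (w : Fin 5 → Fin 5) (h : sgn5 (w 0) (w 1) (w 2) (w 3) (w 4) = -1) :
    pencilT s w = s := by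
  simp [pencilT, aPlus, aMinus, h]

/-- **TWO-WORD PENCIL LEMMA.**  Let `U = (S, u)` be a configuration with co-local long factors `wT` writing the
pencil member `T_s`, and let `w, w'` be two words and `c` a scalar such that EVERY term either (a) has the same
long word at `w` and `w'` and short values in ratio `u_t(w) = −c·u_t(w')`, or (b) has short factor vanishing at
both.  Then `T_s(w) + c·T_s(w') = 0`. -/
theorem twoWord_pencil {N : ℕ} (T : Finset (Fin N)) (S : Fin N → Finset (Fin 5))
    (u wT : Fin N → (Fin 5 → Fin 5) → ℂ) (w w' : Fin 5 → Fin 5) (c s : ℂ)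
    (hw : ∀ t ∈ T, ∀ v v' : Fin 5 → Fin 5, (∀ i, i ∉ S t → v i = v' i) → wT t v = wT t v')
    (hcert : ∀ t ∈ T, ((∀ i, i ∉ S t → w i = w' i) ∧ u t w + c * u t w' = 0) ∨ (u t w = 0 ∧ u t w' = 0))
    (hdesign : ∀ v, (∑ t ∈ T, u t v * wT t v) = pencilT s v) :
    pencilT s w + c * pencilT s w' = 0 := by
  rw [← hdesign w, ← hdesign w', Finset.mul_sum, ← Finset.sum_add_distrib]
  refine Finset.sum_eq_zero fun t ht => ?_
  rcases hcert t ht with ⟨hl, hc⟩ | ⟨h0, h0'⟩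
  · rw [hw t ht w' w (fun i hi => (hl i hi).symm)]
    linear_combination (wT t w) * hc
  · simp [h0, h0']

/-- With `w` even and `w'` odd: `1 + c·s = 0`.  So an ANTISYMMETRIC distinguishing short factor (`c = 1`) lets the
configuration carry only `D₅` among the pencil, a SYMMETRIC one (`c = −1`) only `P₅` (§2b, §2d: `c = 1`;
§2c star border: `c = −1`). -/
theorem twoWord_pencil_sign {N : ℕ} (T : Finset (Fin N)) (S : Fin N → Finset (Fin 5))
    (u wT : Fin N → (Fin 5 → Fin 5) → ℂ) (w w' : Fin 5 → Fin 5) (c s : ℂ)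
    (hpos : sgn5 (w 0) (w 1) (w 2) (w 3) (w 4) = 1) (hneg : sgn5 (w' 0) (w' 1) (w' 2) (w' 3) (w' 4) = -1)
    (hw : ∀ t ∈ T, ∀ v v' : Fin 5 → Fin 5, (∀ i, i ∉ S t → v i = v' i) → wT t v = wT t v')
    (hcert : ∀ t ∈ T, ((∀ i, i ∉ S t → w i = w' i) ∧ u t w + c * u t w' = 0) ∨ (u t w = 0 ∧ u t w' = 0))
    (hdesign : ∀ v, (∑ t ∈ T, u t v * wT t v) = pencilT s v) :
    1 + c * s = 0 := by
  have := twoWord_pencil T S u wT w w' c s hw hcert hdesign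
  rwa [pencilT_of_sgn_pos s w hpos, pencilT_of_sgn_neg s w' hneg] at this

theorem twoWord_only_D5 {N : ℕ} (T : Finset (Fin N)) (S : Fin N → Finset (Fin 5))
    (u wT : Fin N → (Fin 5 → Fin 5) → ℂ) (w w' : Fin 5 → Fin 5) (s : ℂ)
    (hpos : sgn5 (w 0) (w 1) (w 2) (w 3) (w 4) = 1) (hneg : sgn5 (w' 0) (w' 1) (w' 2) (w' 3) (w' 4) = -1)
    (hw : ∀ t ∈ T, ∀ v v' : Fin 5 → Fin 5, (∀ i, i ∉ S t → v i = v' i) → wT t v = wT t v')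
    (hcert : ∀ t ∈ T, ((∀ i, i ∉ S t → w i = w' i) ∧ u t w + u t w' = 0) ∨ (u t w = 0 ∧ u t w' = 0))
    (hdesign : ∀ v, (∑ t ∈ T, u t v * wT t v) = pencilT s v) : s = -1 := by
  have hcert' : ∀ t ∈ T, ((∀ i, i ∉ S t → w i = w' i) ∧ u t w + 1 * u t w' = 0) ∨
      (u t w = 0 ∧ u t w' = 0) := by simpa using hcert
  have := twoWord_pencil_sign T S u wT w w' 1 s hpos hneg hw hcert' hdesign
  linear_combination this

theorem twoWord_only_P5 {N : ℕ} (T : Finset (Fin N)) (S : Fin N → Finset (Fin 5))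
    (u wT : Fin N → (Fin 5 → Fin 5) → ℂ) (w w' : Fin 5 → Fin 5) (s : ℂ)
    (hpos : sgn5 (w 0) (w 1) (w 2) (w 3) (w 4) = 1) (hneg : sgn5 (w' 0) (w' 1) (w' 2) (w' 3) (w' 4) = -1)
    (hw : ∀ t ∈ T, ∀ v v' : Fin 5 → Fin 5, (∀ i, i ∉ S t → v i = v' i) → wT t v = wT t v')
    (hcert : ∀ t ∈ T, ((∀ i, i ∉ S t → w i = w' i) ∧ u t w = u t w') ∨ (u t w = 0 ∧ u t w' = 0))
    (hdesign : ∀ v, (∑ t ∈ T, u t v * wT t v) = pencilT s v) : s = 1 := by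
  have hcert' : ∀ t ∈ T, ((∀ i, i ∉ S t → w i = w' i) ∧ u t w + (-1) * u t w' = 0) ∨
      (u t w = 0 ∧ u t w' = 0) := by
    intro t ht
    rcases hcert t ht with ⟨hl, h⟩ | h
    · exact Or.inl ⟨hl, by rw [h]; ring⟩
    · exact Or.inr h
  have := twoWord_pencil_sign T S u wT w w' (-1) s hpos hneg hw hcert' hdesign
  linear_combination -this

/-- the words `(2,3,0,1,4)` (even) and `(3,2,0,1,4)` (odd). -/
def w23 : Fin 5 → Fin 5 := ![2, 3, 0, 1, 4]
def w32 : Fin 5 → Fin 5 := ![3, 2, 0, 1, 4]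

theorem sgn5_w23 : sgn5 (w23 0) (w23 1) (w23 2) (w23 3) (w23 4) = 1 := by decide
theorem sgn5_w32 : sgn5 (w32 0) (w32 1) (w32 2) (w32 3) (w32 4) = -1 := by decide

/-- the two-word certificate for the typed `2222` system, by `decide`. -/
theorem u8_twoWord_cert : ∀ t : Fin 8,
    ((∀ i, i ∉ S8i t → w23 i = w32 i) ∧ u8 t w23 + u8 t w32 = 0) ∨ (u8 t w23 = 0 ∧ u8 t w32 = 0) := by
  decide

/-- **typed**: ANY co-local long factors on the `2222` short factors writing a pencil member force `s = −1`. -/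
theorem hub2222_typed_pencil_only_D5 (wT : Fin 8 → (Fin 5 → Fin 5) → ℂ) (s : ℂ)
    (hw : ∀ t, ∀ v v' : Fin 5 → Fin 5, (∀ i, i ∉ S8i t → v i = v' i) → wT t v = wT t v')
    (hdesign : ∀ v, (∑ t ∈ (Finset.univ : Finset (Fin 8)), (u8 t v : ℂ) * wT t v) = pencilT s v) :
    s = -1 := by
  refine twoWord_only_D5 Finset.univ S8i (fun t v => (u8 t v : ℂ)) wT w23 w32 s sgn5_w23 sgn5_w32
    (fun t _ => hw t) (fun t _ => ?_) hdesign
  rcases u8_twoWord_cert t with ⟨hl, h⟩ | ⟨h, h'⟩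
  · exact Or.inl ⟨hl, by exact_mod_cast h⟩
  · exact Or.inr ⟨by exact_mod_cast h, by exact_mod_cast h'⟩

theorem u7_twoWord_cert : ∀ t : Fin 7,
    ((∀ i, i ∉ S7i t → w23 i = w32 i) ∧ u7 t w23 + u7 t w32 = 0) ∨ (u7 t w23 = 0 ∧ u7 t w32 = 0) := by
  decide

theorem twohub84_typed_pencil_only_D5 (wT : Fin 7 → (Fin 5 → Fin 5) → ℂ) (s : ℂ)
    (hw : ∀ t, ∀ v v' : Fin 5 → Fin 5, (∀ i, i ∉ S7i t → v i = v' i) → wT t v = wT t v')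
    (hdesign : ∀ v, (∑ t ∈ (Finset.univ : Finset (Fin 7)), (u7 t v : ℂ) * wT t v) = pencilT s v) :
    s = -1 := by
  refine twoWord_only_D5 Finset.univ S7i (fun t v => (u7 t v : ℂ)) wT w23 w32 s sgn5_w23 sgn5_w32
    (fun t _ => hw t) (fun t _ => ?_) hdesign
  rcases u7_twoWord_cert t with ⟨hl, h⟩ | ⟨h, h'⟩
  · exact Or.inl ⟨hl, by exact_mod_cast h⟩
  · exact Or.inr ⟨by exact_mod_cast h, by exact_mod_cast h'⟩

end Summit.ValiantsHypothesis.ValiantsHypothesis.Cruxes.LaplaceOptimalFive.SignPencil
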